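import Literature.Probability.LatticeModels.PlanarIsingFreeTwoPointJordanProofs
import Literature.Probability.LatticeModels.KramersWannierDisorder
import Literature.Probability.LatticeModels.IsingTransport
import Literature.Probability.LatticeModels.PlanarIsingMeshTranslate
import HarnessLib

/-!
# CHI Theorem 1.1 (free b.c.) for Jordan domains from Theorem 1.7 AS PRINTED (mixed families)

Topic `Literature/Probability/LatticeModels`. Companion of `PlanarIsingFreeTwoPointJordanProofs.lean`
towards the named fact `Literature.Probability.LatticeModels.chi_twoPoint_free_jordan`
(Chelkak–Hongler–Izyurov, *Conformal invariance of spin correlations in the planar Ising model*,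
Ann. of Math. 181 (2015) = arXiv:1202.2838, "CHI", Thm 1.1 with free boundary conditions). That file
closed the fact modulo the three children of the split of `chi_onePoint_rho`
(`chi_twoPoint_free_jordan_of_facts h₁ h₂ h₃`), the third of which, `chi_freePlusTwoPoint_ratio`, is
CHI Thm 1.7 in a SAME-family form: free and `+` spins on the same sites `meshInteriorFinset Ω δ`.
What CHI print and prove (Thm 1.7 = Thm 2.19 + Lemma 2.6, eq. (2.12), Kramers–Wannier duality) is a
MIXED-family statement: `𝔼^free_{Ω•_δ}[σ_{a+δ}σ_{b+δ}] / 𝔼⁺_{Ω_δ}[σ_aσ_b] → 𝓑_Ω(a;b)`, the free model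
living on the VERTICES `Ω•_δ` of the face domain `Ω_δ` with the edges of `Ω_δ` — in the tree, for the
`+` volume `Λ = meshInteriorFinset Ω δ ⊆ ℤ²` (faces of CHI = sites of the tree), exactly the Kramers–
Wannier dual `(kwDual Λ, dualSites Λ)` of `KramersWannierDisorder.lean`, the graph on which
`kcCorner_self_eq_isingCorr_free_dual` expresses the Kadanoff–Ceva corner value as a free two-point
function (CHI eq. (2.12)). The passage from the mixed to the same-family form is CHI's remark (p. 19)
"the fact that we have `Ω•_δ - δ` instead of `Ω_δ` plays no role, since they both approximate the
same continuous domain", i.e. universality of Thm 1.1 over approximating families.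

This file proves that remark in the only place the fact needs it, and thereby closes
`chi_twoPoint_free_jordan` modulo CHI Thm 1.5 (`k = 1`), Remark 2.18 and **Thm 1.7 as printed**:

* `meshIsingFreeDualCorr Ω δ p q` — CHI's `𝔼^free_{Ω•_δ}[σ_pσ_q]`: the critical free model on the dual
  graph of the `+` volume (a definition with a body; besides it only a `LocallyFinite` instance for
  translated dual graphs is declared, everything else is a theorem);
* `tendsto_twoPoint_plus_rho_of_mixed` — **CHI §2.9, `+` case, with the mixed Thm 1.7**: the proof of
  `tendsto_twoPoint_rho_of_ratios` (`PlanarIsingTwoPointProofs.lean`) uses the free model only through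
  the FKG/GKS sandwich `𝔼^free_Λ ≤ 𝔼_{ℤ²} ≤ 𝔼⁺` of Lemma 2.24, which holds for the dual free model as
  well (`meshIsingFreeDualCorr_le_twoPointPlus`: `kwDual Λ ≤ ℤ²`, Griffiths' monotonicity in the
  graph and in the volume); the offsets `o₁, o₂` of the marked vertices are absorbed by moving the
  auxiliary marked points of the comparison disc by `±(o₂ - o₁)` lattice steps;
* `tendsto_twoPoint_freeDual_rho_of_mixed` — **CHI Thm 1.1 (free) for CHI's own family** (vertex
  domains): `𝔼^free_{Ω•_δ} ∼ 𝓑_Ω 𝔼⁺_{Ω_δ} ∼ ϱ(δ) ⟨σσ⟩^free_Ω` (p. 19, verbatim);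
* `chi_twoPoint_free_jordan_of_mixed` (and the pointed `chi_twoPoint_free_jordan_of_facts_of_mixed`
  taking the named facts `chi_plusTwoPoint_diagLogDerivative`, `chi_plusTwoPoint_nnRatio`) — the
  fact, by the Griffiths sandwich of `PlanarIsingFreeTwoPointJordanProofs.lean` run with the
  (translated) vertex domains of the inner and outer polyomino approximants of the Jordan domain
  (`eventually_freeDual_inner_le`, `eventually_le_freeDual_outer`: translation is an exact symmetry,
  `isingCorr_map_kwDual_shift`; lattice-adjacent free faces are dual-adjacent,
  `kwDual_adj_of_adj_of_mem`) and the Carathéodory-kernel transport of `⟨σσ⟩^free` proved there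
  (`JordanDomain.exists_inner_outer_approximants_close`).

The hypothesis `hM` (CHI Thm 1.7, mixed form) is quantified like the children of the split: over
admissible `Ω` with `MeshApproximates Ω`, conformal bijections `φ : Ω → ℍ`, a marked point `x` and a
marked point `y_δ → y₀ ≠ x` moving with the mesh; the free spins sit at the dual sites
`[x/δ] + o₁`, `[y_δ/δ] + o₂` for FIXED lattice offsets `o₁ o₂ : Site 2` (which of the vertices
adjacent to the faces `a`, `b` is CHI's "`a + δ`" depends on how the rotated lattice of CHI is laid
on `ℤ²`; every choice is accepted here). Everything is proved; no named fact is introduced.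

## References

* D. Chelkak, C. Hongler, K. Izyurov, Ann. of Math. (2) 181 (2015) 1087–1138; arXiv:1202.2838:
  Thm 1.1, Thm 1.7, Lemma 2.6 eq. (2.12), Lemma 2.24, §2.9 (p. 19) [ChelkakHonglerIzyurovAnnals2015].
* S. Friedli, Y. Velenik, *Statistical Mechanics of Lattice Systems*, CUP 2017: Exercises 3.12, 3.14,
  3.31 (GKS monotonicity in volume and couplings, translation invariance) [FriedliVelenik2017].
-/

noncomputable section

open Filter Topology Metric Set
open Literature.Probability.LatticeModels Literature.Probability.RandomPlanarGeometry

namespace Literature.Probability.LatticeModels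

/-! ### Lattice preliminaries: rounding and translations, mesh points of translates

(`nearestSite_add_meshPoint`, `[(z + δk)/δ] = [z/δ] + k`, is in `PlanarIsingMeshTranslate.lean`.) -/

/-- Additivity of mesh points (a private copy of `meshPoint_add` of `InterfaceSLETightness.lean` /
`meshPoint_add'` of `PlanarIsingRatioLimits.lean`, not imported here). [folklore] -/
private theorem meshPoint_add_site (δ : ℝ) (x y : Site 2) : meshPoint δ (x + y) = meshPoint δ x + meshPoint δ y := by
  apply Complex.ext <;> simp [mul_add]

/-- `[(z - δk)/δ] = [z/δ] - k`. [folklore] -/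
theorem nearestSite_sub_meshPoint {δ : ℝ} (hδ : δ ≠ 0) (z : ℂ) (k : Site 2) :
    nearestSite δ (z - meshPoint δ k) = nearestSite δ z - k := by
  have h := nearestSite_add_meshPoint hδ (z - meshPoint δ k) k
  rw [sub_add_cancel] at h
  rw [h, add_sub_cancel_right]

/-- The norm of a mesh vector: `‖δk‖ ≤ δ (|k₀| + |k₁|)`. [folklore] -/
theorem norm_meshPoint_le {δ : ℝ} (hδ : 0 ≤ δ) (k : Site 2) :
    ‖meshPoint δ k‖ ≤ δ * (|((k 0 : ℤ) : ℝ)| + |((k 1 : ℤ) : ℝ)|) := by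
  refine (Complex.norm_le_abs_re_add_abs_im _).trans ?_
  rw [meshPoint_re, meshPoint_im, abs_mul, abs_mul, abs_of_nonneg hδ, mul_add]

/-- Mesh vectors of a fixed lattice vector tend to `0` with the mesh. [folklore] -/
theorem tendsto_meshPoint_const (k : Site 2) : Tendsto (fun δ : ℝ => meshPoint δ k) (𝓝[>] 0) (𝓝 0) := by
  have h : Tendsto (fun δ : ℝ => meshPoint δ k) (𝓝 0) (𝓝 (meshPoint 0 k)) := by
    have hc : Continuous fun δ : ℝ => meshPoint δ k := by
      have h1 : Continuous fun δ : ℝ => ((δ * (k 0 : ℝ) : ℝ) : ℂ) := by fun_prop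
      have h2 : Continuous fun δ : ℝ => ((δ * (k 1 : ℝ) : ℝ) : ℂ) := by fun_prop
      have : (fun δ : ℝ => meshPoint δ k) = fun δ => ((δ * (k 0 : ℝ) : ℝ) : ℂ) + ((δ * (k 1 : ℝ) : ℝ) : ℂ) * Complex.I := by
        funext δ
        apply Complex.ext <;> simp
      rw [this]
      fun_prop
    exact hc.tendsto 0
  have h0 : meshPoint 0 k = 0 := by apply Complex.ext <;> simp
  rw [h0] at h
  exact h.mono_left nhdsWithin_le_nhds

/-- A marked point translated by a fixed number of lattice steps still converges to the same limit.
[folklore] -/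
theorem tendsto_add_meshPoint {y : ℝ → ℂ} {y₀ : ℂ} (hy : Tendsto y (𝓝[>] 0) (𝓝 y₀)) (k : Site 2) :
    Tendsto (fun δ => y δ + meshPoint δ k) (𝓝[>] 0) (𝓝 y₀) := by
  have := hy.add (tendsto_meshPoint_const k)
  rwa [add_zero] at this

/-- **Translated marked points are eventually free sites**: for `a ∈ Ω` and a fixed lattice vector
`k`, the site `[a/δ] + k` is a free site of `Ω_δ` for small `δ`. [cite: ChelkakHonglerIzyurovAnnals2015, §2.1] -/
theorem eventually_nearestSite_add_mem_meshInteriorFinset {Ω : Set ℂ} (hΩo : IsOpen Ω)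
    (hM : MeshApproximates Ω) {a : ℂ} (ha : a ∈ Ω) (k : Site 2) :
    ∀ᶠ δ in 𝓝[>] (0 : ℝ), nearestSite δ a + k ∈ meshInteriorFinset Ω δ := by
  have h := eventually_nearestSite_mem_of_tendsto hΩo hM ha
    (tendsto_add_meshPoint (tendsto_const_nhds (x := a)) k)
  filter_upwards [h, self_mem_nhdsWithin] with δ hδ hδ0
  rwa [nearestSite_add_meshPoint (ne_of_gt hδ0)] at hδ

/-- Moving version: for `y_δ → y₀ ∈ Ω` and a fixed lattice vector `k`, eventually
`[y_δ/δ] + k` is a free site of `Ω_δ`. [cite: ChelkakHonglerIzyurovAnnals2015, §2.1] -/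
theorem eventually_nearestSite_add_mem_of_tendsto {Ω : Set ℂ} (hΩo : IsOpen Ω) (hM : MeshApproximates Ω)
    {y : ℝ → ℂ} {y₀ : ℂ} (hy₀ : y₀ ∈ Ω) (hy : Tendsto y (𝓝[>] 0) (𝓝 y₀)) (k : Site 2) :
    ∀ᶠ δ in 𝓝[>] (0 : ℝ), nearestSite δ (y δ) + k ∈ meshInteriorFinset Ω δ := by
  have h := eventually_nearestSite_mem_of_tendsto hΩo hM hy₀ (tendsto_add_meshPoint hy k)
  filter_upwards [h, self_mem_nhdsWithin] with δ hδ hδ0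
  rwa [nearestSite_add_meshPoint (ne_of_gt hδ0)] at hδ

/-! ### CHI's free model on the vertices of the face domain: the Kramers–Wannier dual volume -/

/-- **CHI's `𝔼^free_{Ω•_δ}[σ_pσ_q]`**: the critical Ising two-point function with FREE boundary
conditions on the vertex set `Ω•_δ` of the face domain whose faces are the `+` volume
`Λ = meshInteriorFinset Ω δ` of `meshIsingPlusCorr`, with the edges of that face domain — in the
tree's bookkeeping (faces of CHI = sites of `ℤ²`, vertices = plaquettes labelled by lower-left
corners) the Kramers–Wannier dual graph `kwDual Λ` on `dualSites Λ` (`KramersWannierDisorder.lean`),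
the graph of the right-hand side of `kcCorner_self_eq_isingCorr_free_dual` (CHI eq. (2.12)). The
marked dual sites `p, q` are lattice labels. [cite: ChelkakHonglerIzyurovAnnals2015, Lemma 2.6 (the model 𝔼^free_{Ω•_δ}) and Thm. 1.7] -/
def meshIsingFreeDualCorr (Ω : Set ℂ) (δ : ℝ) (p q : Site 2) : ℝ :=
  isingCorr (kwDual (meshInteriorFinset Ω δ)) (dualSites (meshInteriorFinset Ω δ)) criticalBetaTwo 0
    .free {p, q}

/-- A plaquette whose lower-left corner is a site of `Λ` is a dual site of `Λ` (its bottom side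
touches `Λ`). [folklore] -/
theorem mem_dualSites_of_mem {Λ : Finset (Site 2)} {p : Site 2} (hp : p ∈ Λ) : p ∈ dualSites Λ := by
  rw [mem_dualSites]
  refine ⟨0, ?_⟩
  rw [mem_edgesTouching_iff]
  refine ⟨plaqSide_mem_edgeSet p 0, p, hp, ?_⟩
  have h0 : p + cornerOff 0 = p := by ext i; fin_cases i <;> simp [cornerOff]
  rw [plaqSide, h0]
  exact Sym2.mem_mk_left _ _

/-- **GKS sandwich for the vertex model**: `𝔼^free_{Ω•_δ}[σ_pσ_q] ≤ ⟨σ_pσ_q⟩_{ℤ²}` (the plus state of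
`ℤ²`, `twoPointPlus`), for marked dual sites `p ≠ q` of the volume: the dual graph is a subgraph of
`ℤ²` (`kwDual_le`), free correlations increase with the couplings and with the volume, and the free
state is dominated by the plus state. This is the half `𝔼^free_Λ ≤ 𝔼_{ℂ_δ}` of CHI's Lemma 2.24
for `Λ_δ = Ω•_δ`. [cite: ChelkakHonglerIzyurovAnnals2015, Lemma 2.24 (proof); FriedliVelenik2017, Exercises 3.12 and 3.31] -/
theorem meshIsingFreeDualCorr_le_twoPointPlus {Ω : Set ℂ} {δ : ℝ} {p q : Site 2}
    (hp : p ∈ dualSites (meshInteriorFinset Ω δ)) (hq : q ∈ dualSites (meshInteriorFinset Ω δ))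
    (hpq : p ≠ q) :
    meshIsingFreeDualCorr Ω δ p q ≤ twoPointPlus 2 criticalBetaTwo (q - p) := by
  have hA : ({p, q} : Finset (Site 2)) ⊆ dualSites (meshInteriorFinset Ω δ) := by
    intro x hx
    simp only [Finset.mem_insert, Finset.mem_singleton] at hx
    rcases hx with rfl | rfl
    · exact hp
    · exact hq
  rw [meshIsingFreeDualCorr, ← plusCorr_pair_eq_twoPointPlus hpq]
  calc isingCorr (kwDual (meshInteriorFinset Ω δ)) (dualSites (meshInteriorFinset Ω δ)) criticalBetaTwo 0 .free {p, q}
      ≤ isingCorr (zdGraph 2) (dualSites (meshInteriorFinset Ω δ)) criticalBetaTwo 0 .free {p, q} :=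
        isingCorr_free_mono_graph (fun Λ A B β h bc => GKSInequalities.gks_two_holds _) kwDual_le
          criticalBetaTwo_pos.le le_rfl hA
    _ ≤ plusCorr 2 criticalBetaTwo 0 {p, q} := isingCorr_free_le_plusCorr hA

/-- `𝔼^free_{Ω•_δ}[σ_pσ_q]` is symmetric in the marked dual sites. [folklore] -/
theorem meshIsingFreeDualCorr_comm (Ω : Set ℂ) (δ : ℝ) (p q : Site 2) :
    meshIsingFreeDualCorr Ω δ p q = meshIsingFreeDualCorr Ω δ q p := by
  rw [meshIsingFreeDualCorr, meshIsingFreeDualCorr, Finset.pair_comm]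


/-! ### Two marked points moving with the mesh -/

/-- The mesh point of the rounded site of a convergent marked point converges to the same limit.
[folklore] -/
theorem tendsto_meshPoint_nearestSite_of_tendsto {y : ℝ → ℂ} {y₀ : ℂ} (hy : Tendsto y (𝓝[>] 0) (𝓝 y₀)) :
    Tendsto (fun δ => meshPoint δ (nearestSite δ (y δ))) (𝓝[>] 0) (𝓝 y₀) := by
  rw [Metric.tendsto_nhds]
  intro ε hε
  have h1 : ∀ᶠ δ in 𝓝[>] (0 : ℝ), dist (y δ) y₀ < ε / 2 := Metric.tendsto_nhds.1 hy _ (half_pos hε)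
  have h2 : ∀ᶠ δ in 𝓝[>] (0 : ℝ), δ < ε / 2 := mem_nhdsWithin_of_mem_nhds (Iio_mem_nhds (half_pos hε))
  filter_upwards [h1, h2, self_mem_nhdsWithin] with δ hδ1 hδ2 hδ0
  have h3 := dist_meshPoint_nearestSite_le (show (0 : ℝ) < δ from hδ0) (y δ)
  calc dist (meshPoint δ (nearestSite δ (y δ))) y₀
      ≤ dist (meshPoint δ (nearestSite δ (y δ))) (y δ) + dist (y δ) y₀ := dist_triangle _ _ _
    _ < ε / 2 + ε / 2 := add_lt_add_of_le_of_lt (h3.trans hδ2.le) hδ1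
    _ = ε := by ring

/-- Two marked points moving with the mesh towards distinct limits round to distinct sites for small
`δ`. [folklore] -/
theorem eventually_nearestSite_ne_of_tendsto₂ {y y' : ℝ → ℂ} {y₀ y₀' : ℂ} (h : y₀ ≠ y₀')
    (hy : Tendsto y (𝓝[>] 0) (𝓝 y₀)) (hy' : Tendsto y' (𝓝[>] 0) (𝓝 y₀')) :
    ∀ᶠ δ in 𝓝[>] (0 : ℝ), nearestSite δ (y δ) ≠ nearestSite δ (y' δ) := by
  have hd : 0 < dist y₀ y₀' / 2 := half_pos (dist_pos.2 h)
  filter_upwards [Metric.tendsto_nhds.1 (tendsto_meshPoint_nearestSite_of_tendsto hy) _ hd,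
    Metric.tendsto_nhds.1 (tendsto_meshPoint_nearestSite_of_tendsto hy') _ hd] with δ h1 h2 heq
  rw [heq] at h1
  have := dist_triangle_left y₀ y₀' (meshPoint δ (nearestSite δ (y' δ)))
  linarith

/-! ### CHI §2.9, `+` boundary conditions, with Theorem 1.7 in its printed (mixed) form -/

/-- **CHI Theorem 1.1 (`+` boundary conditions, `ϱ`-normalised) for one domain and one pair of
points, from Prop. 2.20 (`hR`, `hRD`) and Theorem 1.7 AS PRINTED** (`hB`, `hBD`: the ratio of the
free two-point function of the VERTEX model `𝔼^free_{Ω•_δ}` at the dual sites `[x/δ] + o₁`,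
`[y_δ/δ] + o₂` and the `+` two-point function of the face model at `[x/δ], [y_δ/δ]` tends to
`𝓑_Ω(x; y₀)`), each for `Ω` and for the unit disc. The proof is that of
`tendsto_twoPoint_rho_of_ratios` (CHI §2.9, pp. 18–19) verbatim, the free model entering only through
Lemma 2.24's sandwich `𝔼^free_Λ ≤ 𝔼_{ℤ²} ≤ 𝔼⁺` (`meshIsingFreeDualCorr_le_twoPointPlus`), with the
auxiliary marked points of the disc moved by `±(o₂ - o₁)` lattice steps so that the displacements
of the marked dual sites match those of the marked faces.
[cite: ChelkakHonglerIzyurovAnnals2015, §2.9 (proof of Thm. 1.1), Lemma 2.24, Thm. 1.7] -/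
theorem tendsto_twoPoint_plus_rho_of_mixed (o₁ o₂ : Site 2) {Ω : Set ℂ} (hΩ : IsAdmissibleDomain Ω)
    (hM : MeshApproximates Ω) {φ : ℂ → ℂ}
    (hφ : IsConformalBijection φ Ω UpperHalfPlane.upperHalfPlaneSet) {c : ℂ → ℂ}
    (hc : IsConformalBijection c (ball (0 : ℂ) 1) UpperHalfPlane.upperHalfPlaneSet)
    (hR : ∀ x ∈ Ω, ∀ (y : ℝ → ℂ) (y₀ y' : ℂ), y₀ ∈ Ω → y' ∈ Ω → y₀ ≠ x → y' ≠ x →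
      Tendsto y (𝓝[>] 0) (𝓝 y₀) →
        Tendsto (fun δ => meshIsingPlusCorr Ω δ ![x, y δ] / meshIsingPlusCorr Ω δ ![x, y'])
          (𝓝[>] 0) (𝓝 (twoPointPlusCHI φ x y₀ / twoPointPlusCHI φ x y')))
    (hB : ∀ x ∈ Ω, ∀ (y : ℝ → ℂ) (y₀ : ℂ), y₀ ∈ Ω → y₀ ≠ x → Tendsto y (𝓝[>] 0) (𝓝 y₀) →
        Tendsto (fun δ => meshIsingFreeDualCorr Ω δ (nearestSite δ x + o₁) (nearestSite δ (y δ) + o₂) /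
            meshIsingPlusCorr Ω δ ![x, y δ]) (𝓝[>] 0) (𝓝 (bCHI (φ x) (φ y₀))))
    (hRD : ∀ x ∈ ball (0 : ℂ) 1, ∀ (y : ℝ → ℂ) (y₀ y' : ℂ), y₀ ∈ ball (0 : ℂ) 1 →
      y' ∈ ball (0 : ℂ) 1 → y₀ ≠ x → y' ≠ x → Tendsto y (𝓝[>] 0) (𝓝 y₀) →
        Tendsto (fun δ => meshIsingPlusCorr (ball (0 : ℂ) 1) δ ![x, y δ] /
            meshIsingPlusCorr (ball (0 : ℂ) 1) δ ![x, y'])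
          (𝓝[>] 0) (𝓝 (twoPointPlusCHI c x y₀ / twoPointPlusCHI c x y')))
    (hBD : ∀ x ∈ ball (0 : ℂ) 1, ∀ (y : ℝ → ℂ) (y₀ : ℂ), y₀ ∈ ball (0 : ℂ) 1 → y₀ ≠ x →
      Tendsto y (𝓝[>] 0) (𝓝 y₀) →
        Tendsto (fun δ => meshIsingFreeDualCorr (ball (0 : ℂ) 1) δ (nearestSite δ x + o₁)
            (nearestSite δ (y δ) + o₂) / meshIsingPlusCorr (ball (0 : ℂ) 1) δ ![x, y δ])
          (𝓝[>] 0) (𝓝 (bCHI (c x) (c y₀))))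
    {a b : ℂ} (ha : a ∈ Ω) (hb : b ∈ Ω) (hab : a ≠ b) :
    Tendsto (fun δ => meshIsingPlusCorr Ω δ ![a, b] / rhoCHI δ) (𝓝[>] 0)
      (𝓝 (twoPointPlusCHI φ a b)) := by
  have hΩo : IsOpen Ω := hΩ.1
  have hDo : IsOpen (ball (0 : ℂ) 1) := isOpen_ball
  have h0D : (0 : ℂ) ∈ ball (0 : ℂ) 1 := mem_ball_self one_pos
  set M := twoPointPlusCHI φ a b with hMdef
  have hM0 : 0 < M := twoPointPlusCHI_pos' hΩo hφ ha hb hab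
  rw [Metric.tendsto_nhds]
  intro e he
  /- Step 1: the tolerance `τ`. -/
  obtain ⟨τ, hτ0, hτ1, hτlo, hτhi⟩ : ∃ τ : ℝ, 0 < τ ∧ τ < 1 / 2 ∧
      M - e / 2 < M * ((1 - τ) ^ 2 / (1 + τ) ^ 2) ∧ M * ((1 + τ) / (1 - τ) ^ 4) < M + e / 2 := by
    have hc1 : Tendsto (fun τ : ℝ => M * ((1 - τ) ^ 2 / (1 + τ) ^ 2)) (𝓝 0) (𝓝 M) := by
      have h : Tendsto (fun τ : ℝ => M * ((1 - τ) ^ 2 / (1 + τ) ^ 2)) (𝓝 0)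
          (𝓝 (M * ((1 - 0) ^ 2 / (1 + 0) ^ 2))) :=
        (((tendsto_const_nhds.sub tendsto_id).pow 2).div ((tendsto_const_nhds.add tendsto_id).pow 2)
          (by norm_num)).const_mul M
      norm_num at h
      exact h
    have hc2 : Tendsto (fun τ : ℝ => M * ((1 + τ) / (1 - τ) ^ 4)) (𝓝 0) (𝓝 M) := by
      have h : Tendsto (fun τ : ℝ => M * ((1 + τ) / (1 - τ) ^ 4)) (𝓝 0)
          (𝓝 (M * ((1 + 0) / (1 - 0) ^ 4))) :=
        ((tendsto_const_nhds.add tendsto_id).div ((tendsto_const_nhds.sub tendsto_id).pow 4)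
          (by norm_num)).const_mul M
      norm_num at h
      exact h
    have e1 : ∀ᶠ τ in 𝓝[>] (0 : ℝ), M - e / 2 < M * ((1 - τ) ^ 2 / (1 + τ) ^ 2) :=
      mem_nhdsWithin_of_mem_nhds (hc1.eventually_const_lt (by linarith))
    have e2 : ∀ᶠ τ in 𝓝[>] (0 : ℝ), M * ((1 + τ) / (1 - τ) ^ 4) < M + e / 2 :=
      mem_nhdsWithin_of_mem_nhds (hc2.eventually_lt_const (by linarith))
    have e3 : ∀ᶠ τ in 𝓝[>] (0 : ℝ), τ < 1 / 2 :=
      mem_nhdsWithin_of_mem_nhds (Iio_mem_nhds (by norm_num))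
    have e0 : ∀ᶠ τ in 𝓝[>] (0 : ℝ), 0 < τ := self_mem_nhdsWithin
    obtain ⟨τ, h0, h3, h1, h2⟩ := (e0.and (e3.and (e1.and e2))).exists
    exact ⟨τ, h0, h3, h1, h2⟩
  have h1τ : 0 < 1 - τ := by linarith
  /- Step 2: the auxiliary scale `ε` (continuum limits in `Ω` as `a + ε → a`). -/
  obtain ⟨ε, hε0, haε, hA3, hβΩ⟩ : ∃ ε : ℝ, 0 < ε ∧ a + (ε : ℂ) ∈ Ω ∧
      dist (twoPointPlusCHI φ a (a + ε) * ‖(a + ε) - a‖ ^ ((1 : ℝ) / 4)) 1 < τ ∧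
      1 - τ < bCHI (φ a) (φ (a + ε)) := by
    have hp := tendsto_add_ofReal_nhdsNE a
    have e0 : ∀ᶠ ε : ℝ in 𝓝[>] 0, 0 < ε := self_mem_nhdsWithin
    have e1 : ∀ᶠ ε : ℝ in 𝓝[>] 0, a + (ε : ℂ) ∈ Ω :=
      hp.eventually (mem_nhdsWithin_of_mem_nhds (hΩo.mem_nhds ha))
    have e2 : ∀ᶠ ε : ℝ in 𝓝[>] 0,
        dist (twoPointPlusCHI φ a (a + (ε : ℂ)) * ‖(a + (ε : ℂ)) - a‖ ^ ((1 : ℝ) / 4)) 1 < τ :=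
      Metric.tendsto_nhds.1 ((tendsto_twoPointPlusCHI_mul_rpow_norm hΩo hφ ha).comp hp) τ hτ0
    have e3 : ∀ᶠ ε : ℝ in 𝓝[>] 0, 1 - τ < bCHI (φ a) (φ (a + (ε : ℂ))) :=
      ((tendsto_bCHI_nhdsNE hΩo hφ ha).comp hp).eventually_const_lt (by linarith)
    obtain ⟨ε, h0, h1, h2, h3⟩ := (e0.and (e1.and (e2.and e3))).exists
    exact ⟨ε, h0, h1, h2, h3⟩
  set aε : ℂ := a + (ε : ℂ) with haε_def
  have haεa : aε ≠ a := by
    intro h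
    have h' := congrArg Complex.re h
    simp only [haε_def, Complex.add_re, Complex.ofReal_re] at h'
    linarith
  have hL3 : 0 < twoPointPlusCHI φ a aε := twoPointPlusCHI_pos' hΩo hφ ha haε haεa.symm
  have hβΩpos : 0 < bCHI (φ a) (φ aε) := by linarith
  /- Step 3: the comparison radius `R` (continuum limits in `𝔻` at `0`). -/
  obtain ⟨R, hR1, hRε, hA1, hA2, hβ1, hβ2⟩ : ∃ R : ℝ, 1 < R ∧ ε < R ∧
      dist (twoPointPlusCHI c 0 ((ε : ℂ) / R) * ‖(ε : ℂ) / R - 0‖ ^ ((1 : ℝ) / 4)) 1 < τ ∧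
      dist (twoPointPlusCHI c 0 ((Complex.mk (Real.sqrt 2 / 2) (Real.sqrt 2 / 2)) / R) * ‖(Complex.mk (Real.sqrt 2 / 2) (Real.sqrt 2 / 2)) / R - 0‖ ^ ((1 : ℝ) / 4)) 1 < τ ∧
      1 - τ < bCHI (c 0) (c ((ε : ℂ) / R)) ∧ 1 - τ < bCHI (c 0) (c ((Complex.mk (Real.sqrt 2 / 2) (Real.sqrt 2 / 2)) / R)) := by
    have hp1 := tendsto_div_ofReal_atTop_nhdsNE (w := (ε : ℂ)) (by exact_mod_cast hε0.ne')
    have hp2 := tendsto_div_ofReal_atTop_nhdsNE pOne_ne_zero_CHI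
    have hC := tendsto_twoPointPlusCHI_mul_rpow_norm hDo hc h0D
    have hBl := tendsto_bCHI_nhdsNE hDo hc h0D
    have e1 : ∀ᶠ R in atTop, (1 : ℝ) < R := eventually_gt_atTop 1
    have e2 : ∀ᶠ R in atTop, ε < R := eventually_gt_atTop ε
    have e3 : ∀ᶠ R : ℝ in atTop,
        dist (twoPointPlusCHI c 0 ((ε : ℂ) / R) * ‖(ε : ℂ) / R - 0‖ ^ ((1 : ℝ) / 4)) 1 < τ :=
      Metric.tendsto_nhds.1 (hC.comp hp1) τ hτ0
    have e4 : ∀ᶠ R : ℝ in atTop,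
        dist (twoPointPlusCHI c 0 ((Complex.mk (Real.sqrt 2 / 2) (Real.sqrt 2 / 2)) / R) * ‖(Complex.mk (Real.sqrt 2 / 2) (Real.sqrt 2 / 2)) / R - 0‖ ^ ((1 : ℝ) / 4)) 1 < τ :=
      Metric.tendsto_nhds.1 (hC.comp hp2) τ hτ0
    have e5 : ∀ᶠ R : ℝ in atTop, 1 - τ < bCHI (c 0) (c ((ε : ℂ) / R)) :=
      (hBl.comp hp1).eventually_const_lt (by linarith)
    have e6 : ∀ᶠ R : ℝ in atTop, 1 - τ < bCHI (c 0) (c ((Complex.mk (Real.sqrt 2 / 2) (Real.sqrt 2 / 2)) / R)) :=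
      (hBl.comp hp2).eventually_const_lt (by linarith)
    obtain ⟨R, h1, h2, h3, h4, h5, h6⟩ := (e1.and (e2.and (e3.and (e4.and (e5.and e6))))).exists
    exact ⟨R, h1, h2, h3, h4, h5, h6⟩
  have hR0 : 0 < R := by linarith
  set y₀ : ℂ := (ε : ℂ) / R with hy₀_def
  set pR : ℂ := (Complex.mk (Real.sqrt 2 / 2) (Real.sqrt 2 / 2)) / R with hpR_def
  have hy₀D : y₀ ∈ ball (0 : ℂ) 1 := by
    rw [mem_ball, dist_zero_right, hy₀_def, norm_div, Complex.norm_real, Complex.norm_real,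
      Real.norm_eq_abs, Real.norm_eq_abs, abs_of_pos hε0, abs_of_pos hR0, div_lt_one hR0]
    exact hRε
  have hpRD : pR ∈ ball (0 : ℂ) 1 := by
    rw [mem_ball, dist_zero_right, hpR_def, norm_div, norm_pOne_CHI, Complex.norm_real,
      Real.norm_eq_abs, abs_of_pos hR0, div_lt_one hR0]
    exact hR1
  have hy₀0 : y₀ ≠ 0 := div_ne_zero (by exact_mod_cast hε0.ne') (by exact_mod_cast hR0.ne')
  have hpR0 : pR ≠ 0 := div_ne_zero pOne_ne_zero_CHI (by exact_mod_cast hR0.ne')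
  have hL1 : 0 < twoPointPlusCHI c 0 y₀ := twoPointPlusCHI_pos' hDo hc h0D hy₀D hy₀0.symm
  have hL2 : 0 < twoPointPlusCHI c 0 pR := twoPointPlusCHI_pos' hDo hc h0D hpRD hpR0.symm
  have hβ1pos : 0 < bCHI (c 0) (c y₀) := by linarith
  have hβ2pos : 0 < bCHI (c 0) (c pR) := by linarith
  /- Step 4: the lattice displacement `v δ = [aε/δ] - [a/δ]`, the offset `Δ = o₂ - o₁`, and the
  moving marked points of `𝔻`: `yU` rounds to `v δ + Δ`, `yL` to `v δ - Δ`, `pL` to `[p₁/δ] - Δ`. -/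
  set Δ : Site 2 := o₂ - o₁ with hΔ_def
  set v : ℝ → Site 2 := fun δ => nearestSite δ aε - nearestSite δ a with hv_def
  set yU : ℝ → ℂ := fun δ' => meshPoint δ' (v (R * δ') + Δ) with hyU_def
  set yL : ℝ → ℂ := fun δ' => meshPoint δ' (v (R * δ') - Δ) with hyL_def
  set pL : ℝ → ℂ := fun δ' => meshPoint δ' (nearestSite δ' pR - Δ) with hpL_def
  have hT : Tendsto (fun δ : ℝ => δ / R) (𝓝[>] 0) (𝓝[>] 0) := by
    refine tendsto_nhdsWithin_iff.2 ⟨?_, ?_⟩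
    · have h : Tendsto (fun δ : ℝ => δ / R) (𝓝 0) (𝓝 (0 / R)) := tendsto_id.div_const R
      rw [zero_div] at h
      exact h.mono_left nhdsWithin_le_nhds
    · filter_upwards [self_mem_nhdsWithin] with δ hδ
      exact div_pos hδ hR0
  have hTm : Tendsto (fun δ : ℝ => R * δ) (𝓝[>] 0) (𝓝[>] 0) := by
    refine tendsto_nhdsWithin_iff.2 ⟨?_, ?_⟩
    · have h : Tendsto (fun δ : ℝ => R * δ) (𝓝 0) (𝓝 (R * 0)) := tendsto_id.const_mul R
      rw [mul_zero] at h
      exact h.mono_left nhdsWithin_le_nhds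
    · filter_upwards [self_mem_nhdsWithin] with δ hδ
      exact mul_pos hR0 hδ
  have hvT : Tendsto (fun δ => meshPoint δ (v δ)) (𝓝[>] 0) (𝓝 (ε : ℂ)) := by
    have h := tendsto_meshPoint_nearestSite_sub a aε
    rwa [haε_def, add_sub_cancel_left] at h
  have hRC : (R : ℂ) ≠ 0 := by exact_mod_cast hR0.ne'
  have hyD : Tendsto (fun δ' => meshPoint δ' (v (R * δ'))) (𝓝[>] 0) (𝓝 y₀) := by
    have h := (hvT.comp hTm).const_mul ((R : ℂ)⁻¹)
    refine (h.congr' (Eventually.of_forall fun δ' => ?_)).trans ?_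
    · simp only [Function.comp_def]
      have hmul : meshPoint (R * δ') (v (R * δ')) = (R : ℂ) * meshPoint δ' (v (R * δ')) := by
        apply Complex.ext <;> simp [mul_assoc]
      rw [hmul, ← mul_assoc, inv_mul_cancel₀ hRC, one_mul]
    · rw [hy₀_def, div_eq_inv_mul]
  have hyU : Tendsto yU (𝓝[>] 0) (𝓝 y₀) := by
    have h := tendsto_add_meshPoint hyD Δ
    refine h.congr' (Eventually.of_forall fun δ' => ?_)
    simp only [hyU_def, meshPoint_add_site]
  have hyL : Tendsto yL (𝓝[>] 0) (𝓝 y₀) := by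
    have h := tendsto_add_meshPoint hyD (-Δ)
    refine h.congr' (Eventually.of_forall fun δ' => ?_)
    simp only [hyL_def, sub_eq_add_neg, meshPoint_add_site]
  have hpL : Tendsto pL (𝓝[>] 0) (𝓝 pR) := by
    have h := tendsto_add_meshPoint (tendsto_meshPoint_nearestSite_of_tendsto
      (tendsto_const_nhds (x := pR) (f := (𝓝[>] (0 : ℝ))))) (-Δ)
    refine h.congr' (Eventually.of_forall fun δ' => ?_)
    simp only [hpL_def, sub_eq_add_neg, meshPoint_add_site]
  -- identities at `δ`: the marked points of `𝔻` at mesh `δ / R` round as designed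
  have hid_p : ∀ δ, nearestSite (δ / R) pR = nearestSite δ (Complex.mk (Real.sqrt 2 / 2) (Real.sqrt 2 / 2)) := fun δ =>
    nearestSite_div δ hR0.ne' (Complex.mk (Real.sqrt 2 / 2) (Real.sqrt 2 / 2))
  have hid_yU : ∀ δ, 0 < δ → nearestSite (δ / R) (yU (δ / R)) = v δ + Δ := by
    intro δ hδ
    simp only [hyU_def]
    rw [mul_div_cancel₀ δ hR0.ne', nearestSite_meshPoint (div_pos hδ hR0).ne']
  have hid_yL : ∀ δ, 0 < δ → nearestSite (δ / R) (yL (δ / R)) = v δ - Δ := by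
    intro δ hδ
    simp only [hyL_def]
    rw [mul_div_cancel₀ δ hR0.ne', nearestSite_meshPoint (div_pos hδ hR0).ne']
  have hid_pL : ∀ δ, 0 < δ → nearestSite (δ / R) (pL (δ / R)) =
      nearestSite δ (Complex.mk (Real.sqrt 2 / 2) (Real.sqrt 2 / 2)) - Δ := by
    intro δ hδ
    simp only [hpL_def]
    rw [nearestSite_meshPoint (div_pos hδ hR0).ne', hid_p]
  /- Step 5: limits of the lattice ratios (the hypotheses). -/
  have gF1 : Tendsto (fun δ => meshIsingPlusCorr Ω δ ![a, b] / meshIsingPlusCorr Ω δ ![a, aε])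
      (𝓝[>] 0) (𝓝 (M / twoPointPlusCHI φ a aε)) :=
    hR a ha (fun _ => b) b aε hb haε hab.symm haεa tendsto_const_nhds
  have gX : Tendsto (fun δ => meshIsingFreeDualCorr Ω δ (nearestSite δ a + o₁) (nearestSite δ aε + o₂) /
      meshIsingPlusCorr Ω δ ![a, aε]) (𝓝[>] 0) (𝓝 (bCHI (φ a) (φ aε))) :=
    hB a ha (fun _ => aε) aε haε haεa tendsto_const_nhds
  have gDU : Tendsto (fun δ => meshIsingPlusCorr (ball (0 : ℂ) 1) (δ / R) ![0, yU (δ / R)] /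
      meshIsingPlusCorr (ball (0 : ℂ) 1) (δ / R) ![0, pR]) (𝓝[>] 0)
      (𝓝 (twoPointPlusCHI c 0 y₀ / twoPointPlusCHI c 0 pR)) :=
    (hRD 0 h0D yU y₀ pR hy₀D hpRD hy₀0 hpR0 hyU).comp hT
  have gDL : Tendsto (fun δ => meshIsingPlusCorr (ball (0 : ℂ) 1) (δ / R) ![0, yL (δ / R)] /
      meshIsingPlusCorr (ball (0 : ℂ) 1) (δ / R) ![0, pR]) (𝓝[>] 0)
      (𝓝 (twoPointPlusCHI c 0 y₀ / twoPointPlusCHI c 0 pR)) :=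
    (hRD 0 h0D yL y₀ pR hy₀D hpRD hy₀0 hpR0 hyL).comp hT
  have gPL : Tendsto (fun δ => meshIsingPlusCorr (ball (0 : ℂ) 1) (δ / R) ![0, pL (δ / R)] /
      meshIsingPlusCorr (ball (0 : ℂ) 1) (δ / R) ![0, pR]) (𝓝[>] 0) (𝓝 1) := by
    have h := (hRD 0 h0D pL pR pR hpRD hpRD hpR0 hpR0 hpL).comp hT
    rwa [div_self hL2.ne'] at h
  have gβ1 : Tendsto (fun δ => meshIsingFreeDualCorr (ball (0 : ℂ) 1) (δ / R) (nearestSite (δ / R) 0 + o₁)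
      (nearestSite (δ / R) (yL (δ / R)) + o₂) /
      meshIsingPlusCorr (ball (0 : ℂ) 1) (δ / R) ![0, yL (δ / R)]) (𝓝[>] 0)
      (𝓝 (bCHI (c 0) (c y₀))) :=
    (hBD 0 h0D yL y₀ hy₀D hy₀0 hyL).comp hT
  have gβ2 : Tendsto (fun δ => meshIsingFreeDualCorr (ball (0 : ℂ) 1) (δ / R) (nearestSite (δ / R) 0 + o₁)
      (nearestSite (δ / R) (pL (δ / R)) + o₂) /
      meshIsingPlusCorr (ball (0 : ℂ) 1) (δ / R) ![0, pL (δ / R)]) (𝓝[>] 0)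
      (𝓝 (bCHI (c 0) (c pR))) :=
    (hBD 0 h0D pL pR hpRD hpR0 hpL).comp hT
  /- Step 6: eventual lattice facts. -/
  have sΩ : ∀ᶠ δ in 𝓝[>] (0 : ℝ), nearestSite δ a + o₁ ∈ meshInteriorFinset Ω δ ∧
      nearestSite δ aε + o₂ ∈ meshInteriorFinset Ω δ ∧ nearestSite δ a ≠ nearestSite δ aε ∧
      nearestSite δ a ≠ nearestSite δ b ∧ nearestSite δ a + o₁ ≠ nearestSite δ aε + o₂ := by
    have hne : ∀ᶠ δ in 𝓝[>] (0 : ℝ), nearestSite δ (a + meshPoint δ o₁) ≠ nearestSite δ (aε + meshPoint δ o₂) :=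
      eventually_nearestSite_ne_of_tendsto₂ haεa.symm (tendsto_add_meshPoint tendsto_const_nhds o₁)
        (tendsto_add_meshPoint tendsto_const_nhds o₂)
    filter_upwards [eventually_nearestSite_add_mem_meshInteriorFinset hΩo hM ha o₁,
      eventually_nearestSite_add_mem_meshInteriorFinset hΩo hM haε o₂, eventually_nearestSite_ne haεa.symm,
      eventually_nearestSite_ne hab, hne, self_mem_nhdsWithin] with δ h1 h2 h3 h4 h5 hδ
    rw [nearestSite_add_meshPoint (ne_of_gt hδ), nearestSite_add_meshPoint (ne_of_gt hδ)] at h5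
    exact ⟨h1, h2, h3, h4, h5⟩
  have sD : ∀ᶠ δ in 𝓝[>] (0 : ℝ),
      nearestSite (δ / R) 0 + o₁ ∈ meshInteriorFinset (ball (0 : ℂ) 1) (δ / R) ∧
      nearestSite (δ / R) (yL (δ / R)) + o₂ ∈ meshInteriorFinset (ball (0 : ℂ) 1) (δ / R) ∧
      nearestSite (δ / R) (pL (δ / R)) + o₂ ∈ meshInteriorFinset (ball (0 : ℂ) 1) (δ / R) ∧
      nearestSite (δ / R) 0 ≠ nearestSite (δ / R) (yU (δ / R)) ∧
      nearestSite (δ / R) 0 ≠ nearestSite (δ / R) (yL (δ / R)) ∧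
      nearestSite (δ / R) 0 ≠ nearestSite (δ / R) (pL (δ / R)) ∧
      nearestSite (δ / R) 0 ≠ nearestSite (δ / R) pR := by
    have h := (eventually_nearestSite_add_mem_meshInteriorFinset hDo meshApproximates_ball h0D o₁).and
      ((eventually_nearestSite_add_mem_of_tendsto hDo meshApproximates_ball hy₀D hyL o₂).and
      ((eventually_nearestSite_add_mem_of_tendsto hDo meshApproximates_ball hpRD hpL o₂).and
      ((eventually_nearestSite_ne_of_tendsto hy₀0 hyU).and
      ((eventually_nearestSite_ne_of_tendsto hy₀0 hyL).and
      ((eventually_nearestSite_ne_of_tendsto hpR0 hpL).and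
      (eventually_nearestSite_ne (Ne.symm hpR0)))))))
    filter_upwards [hT.eventually h] with δ hδ
    exact ⟨hδ.1, hδ.2.1, hδ.2.2.1, hδ.2.2.2.1, hδ.2.2.2.2.1, hδ.2.2.2.2.2.1, hδ.2.2.2.2.2.2⟩
  -- positivity of the free correlations, from the limits
  have posF : ∀ᶠ δ in 𝓝[>] (0 : ℝ),
      0 < meshIsingFreeDualCorr Ω δ (nearestSite δ a + o₁) (nearestSite δ aε + o₂) /
        meshIsingPlusCorr Ω δ ![a, aε] :=
    gX.eventually_const_lt hβΩpos
  have posFD : ∀ᶠ δ in 𝓝[>] (0 : ℝ), 0 < meshIsingFreeDualCorr (ball (0 : ℂ) 1) (δ / R)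
      (nearestSite (δ / R) 0 + o₁) (nearestSite (δ / R) (pL (δ / R)) + o₂) /
      meshIsingPlusCorr (ball (0 : ℂ) 1) (δ / R) ![0, pL (δ / R)] :=
    gβ2.eventually_const_lt hβ2pos
  /- Step 7: the sandwich, eventually. Notation: `T = ⟨σ_0σ_{v δ}⟩_{ℤ²}`, `TU = ⟨σ_0σ_{v δ + Δ}⟩_{ℤ²}`,
  `ρ = ϱ(δ)`. -/
  have main : ∀ᶠ δ in 𝓝[>] (0 : ℝ),
      meshIsingPlusCorr Ω δ ![a, b] / meshIsingPlusCorr Ω δ ![a, aε] *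
          (meshIsingFreeDualCorr (ball (0 : ℂ) 1) (δ / R) (nearestSite (δ / R) 0 + o₁)
              (nearestSite (δ / R) (yL (δ / R)) + o₂) /
              meshIsingPlusCorr (ball (0 : ℂ) 1) (δ / R) ![0, yL (δ / R)] *
            (meshIsingPlusCorr (ball (0 : ℂ) 1) (δ / R) ![0, yL (δ / R)] /
              meshIsingPlusCorr (ball (0 : ℂ) 1) (δ / R) ![0, pR])) ≤
        meshIsingPlusCorr Ω δ ![a, b] / rhoCHI δ ∧
      meshIsingPlusCorr Ω δ ![a, b] / rhoCHI δ ≤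
        meshIsingPlusCorr Ω δ ![a, b] / meshIsingPlusCorr Ω δ ![a, aε] *
          (meshIsingFreeDualCorr Ω δ (nearestSite δ a + o₁) (nearestSite δ aε + o₂) /
              meshIsingPlusCorr Ω δ ![a, aε])⁻¹ *
          (meshIsingPlusCorr (ball (0 : ℂ) 1) (δ / R) ![0, yU (δ / R)] /
              meshIsingPlusCorr (ball (0 : ℂ) 1) (δ / R) ![0, pR] *
            ((meshIsingPlusCorr (ball (0 : ℂ) 1) (δ / R) ![0, pL (δ / R)] /
                meshIsingPlusCorr (ball (0 : ℂ) 1) (δ / R) ![0, pR])⁻¹ *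
              (meshIsingFreeDualCorr (ball (0 : ℂ) 1) (δ / R) (nearestSite (δ / R) 0 + o₁)
                  (nearestSite (δ / R) (pL (δ / R)) + o₂) /
                meshIsingPlusCorr (ball (0 : ℂ) 1) (δ / R) ![0, pL (δ / R)])⁻¹)) := by
    filter_upwards [sΩ, sD, posF, posFD, self_mem_nhdsWithin] with δ hsΩ hsD hposF hposFD hδ0
    have hδ0' : (0 : ℝ) < δ := hδ0
    obtain ⟨maΩ, mεΩ, neaε, neab, neaεo⟩ := hsΩ
    obtain ⟨m0D, myL, mpL, ne0yU, ne0yL, ne0pL, ne0p⟩ := hsD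
    -- abbreviations
    set Pab := meshIsingPlusCorr Ω δ ![a, b]
    set Paε := meshIsingPlusCorr Ω δ ![a, aε]
    set Faε := meshIsingFreeDualCorr Ω δ (nearestSite δ a + o₁) (nearestSite δ aε + o₂)
    set PDU := meshIsingPlusCorr (ball (0 : ℂ) 1) (δ / R) ![0, yU (δ / R)]
    set PDL := meshIsingPlusCorr (ball (0 : ℂ) 1) (δ / R) ![0, yL (δ / R)]
    set FDL := meshIsingFreeDualCorr (ball (0 : ℂ) 1) (δ / R) (nearestSite (δ / R) 0 + o₁)
      (nearestSite (δ / R) (yL (δ / R)) + o₂)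
    set PDp := meshIsingPlusCorr (ball (0 : ℂ) 1) (δ / R) ![0, pR]
    set PDpL := meshIsingPlusCorr (ball (0 : ℂ) 1) (δ / R) ![0, pL (δ / R)]
    set FDpL := meshIsingFreeDualCorr (ball (0 : ℂ) 1) (δ / R) (nearestSite (δ / R) 0 + o₁)
      (nearestSite (δ / R) (pL (δ / R)) + o₂)
    set T := twoPointPlus 2 criticalBetaTwo (v δ)
    set TU := twoPointPlus 2 criticalBetaTwo (v δ + Δ)
    set ρ := rhoCHI δ
    -- the rounded marked dual sites of `𝔻`
    have h0 : nearestSite (δ / R) 0 = 0 := nearestSite_zero _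
    have eL : nearestSite (δ / R) (yL (δ / R)) + o₂ = v δ + o₁ := by
      rw [hid_yL δ hδ0', hΔ_def]; abel
    have epL : nearestSite (δ / R) (pL (δ / R)) + o₂ =
        nearestSite δ (Complex.mk (Real.sqrt 2 / 2) (Real.sqrt 2 / 2)) + o₁ := by
      rw [hid_pL δ hδ0', hΔ_def]; abel
    have hv0 : v δ ≠ 0 := fun h => neaε (eq_of_sub_eq_zero h).symm
    have hp0 : nearestSite δ (Complex.mk (Real.sqrt 2 / 2) (Real.sqrt 2 / 2)) ≠ 0 := by
      rw [← hid_p δ, ← h0]; exact ne0p.symm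
    -- the six comparisons with the plus state of `ℤ²`
    have i1 : T ≤ Paε := twoPointPlus_le_meshIsingPlusCorr_two Ω δ neaε
    have i2 : Faε ≤ TU := by
      have h := meshIsingFreeDualCorr_le_twoPointPlus (mem_dualSites_of_mem maΩ) (mem_dualSites_of_mem mεΩ) neaεo
      have e : nearestSite δ aε + o₂ - (nearestSite δ a + o₁) = v δ + Δ := add_sub_add_comm _ _ _ _
      rwa [e] at h
    have i3 : TU ≤ PDU := by
      have h := twoPointPlus_le_meshIsingPlusCorr_two (ball (0 : ℂ) 1) (δ / R) ne0yU
      rwa [hid_yU δ hδ0', h0, sub_zero] at h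
    have i4 : FDL ≤ T := by
      have hne : nearestSite (δ / R) 0 + o₁ ≠ nearestSite (δ / R) (yL (δ / R)) + o₂ := by
        rw [eL, h0, zero_add]
        intro h
        exact hv0 (by simpa using h.symm)
      have h := meshIsingFreeDualCorr_le_twoPointPlus (mem_dualSites_of_mem m0D) (mem_dualSites_of_mem myL) hne
      have e : nearestSite (δ / R) (yL (δ / R)) + o₂ - (nearestSite (δ / R) 0 + o₁) = v δ := by
        rw [eL, h0, zero_add, add_sub_cancel_right]
      rwa [e] at h
    have i5 : ρ ≤ PDp := by
      have h := twoPointPlus_le_meshIsingPlusCorr_two (ball (0 : ℂ) 1) (δ / R) ne0p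
      rwa [hid_p δ, h0, sub_zero, ← rhoCHI_eq] at h
    have i6 : FDpL ≤ ρ := by
      have hne : nearestSite (δ / R) 0 + o₁ ≠ nearestSite (δ / R) (pL (δ / R)) + o₂ := by
        rw [epL, h0, zero_add]
        intro h
        exact hp0 (by simpa using h.symm)
      have h := meshIsingFreeDualCorr_le_twoPointPlus (mem_dualSites_of_mem m0D) (mem_dualSites_of_mem mpL) hne
      have e : nearestSite (δ / R) (pL (δ / R)) + o₂ - (nearestSite (δ / R) 0 + o₁) =
          nearestSite δ (Complex.mk (Real.sqrt 2 / 2) (Real.sqrt 2 / 2)) := by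
        rw [epL, h0, zero_add, add_sub_cancel_right]
      rwa [e, ← rhoCHI_eq] at h
    have posab : 0 < Pab :=
      lt_of_lt_of_le (twoPointPlus_pos criticalBetaTwo_pos _)
        (twoPointPlus_le_meshIsingPlusCorr_two Ω δ neab)
    have hT0 : 0 < T := twoPointPlus_pos criticalBetaTwo_pos _
    have hTU0 : 0 < TU := twoPointPlus_pos criticalBetaTwo_pos _
    have hρ0 : 0 < ρ := rhoCHI_pos δ
    have hPaε : 0 < Paε := lt_of_lt_of_le hT0 i1
    have hPDU : 0 < PDU := lt_of_lt_of_le hTU0 i3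
    have hPDL : 0 < PDL :=
      lt_of_lt_of_le (twoPointPlus_pos criticalBetaTwo_pos _)
        (twoPointPlus_le_meshIsingPlusCorr_two (ball (0 : ℂ) 1) (δ / R) ne0yL)
    have hPDpL : 0 < PDpL :=
      lt_of_lt_of_le (twoPointPlus_pos criticalBetaTwo_pos _)
        (twoPointPlus_le_meshIsingPlusCorr_two (ball (0 : ℂ) 1) (δ / R) ne0pL)
    have hPDp : 0 < PDp := lt_of_lt_of_le hρ0 i5
    have hFaε : 0 < Faε := (div_pos_iff_of_pos_right hPaε).1 hposF
    have hFDpL : 0 < FDpL := (div_pos_iff_of_pos_right hPDpL).1 hposFD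
    constructor
    · -- lower bound: `𝔼^free_{𝔻•} ≤ T ≤ 𝔼⁺_Ω[σ_aσ_{aε}]` and `ϱ ≤ 𝔼⁺_𝔻[σ_0σ_{p_R}]`
      have e1 : FDL / PDL * (PDL / PDp) = FDL / PDp := by field_simp
      have e2 : FDL / PDp ≤ Paε / ρ := div_le_div₀ hPaε.le (i4.trans i1) hρ0 i5
      have e3 : Pab / Paε * (Paε / ρ) = Pab / ρ := by field_simp
      rw [e1]
      calc Pab / Paε * (FDL / PDp) ≤ Pab / Paε * (Paε / ρ) :=
            mul_le_mul_of_nonneg_left e2 (div_nonneg posab.le hPaε.le)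
        _ = Pab / ρ := e3
    · -- upper bound: `𝔼^free_{Ω•}[σσ] ≤ TU ≤ 𝔼⁺_𝔻[σ_0σ_{yU}]` and `𝔼^free_{𝔻•}[σ_{o₁}σ_{[p₁/δ]+o₁}] ≤ ϱ`
      have e1 : Pab / Paε * (Faε / Paε)⁻¹ * (PDU / PDp * ((PDpL / PDp)⁻¹ * (FDpL / PDpL)⁻¹)) =
          Pab / Faε * (PDU / FDpL) := by
        field_simp
      have e3 : Pab / ρ = Pab / Faε * (Faε / ρ) := by field_simp
      have e4 : Faε / ρ ≤ PDU / FDpL := div_le_div₀ hPDU.le (i2.trans i3) hFDpL i6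
      rw [e1, e3]
      exact mul_le_mul_of_nonneg_left e4 (div_nonneg posab.le hFaε.le)
  /- Step 8: the limits of the two bounds, and their values. -/
  set L1 := twoPointPlusCHI c 0 y₀ with hL1_def
  set L2 := twoPointPlusCHI c 0 pR with hL2_def
  set L3 := twoPointPlusCHI φ a aε with hL3_def
  set β₁ := bCHI (c 0) (c y₀) with hβ₁_def
  set β₂ := bCHI (c 0) (c pR) with hβ₂_def
  set βΩ := bCHI (φ a) (φ aε) with hβΩ_def
  have glo : Tendsto (fun δ => meshIsingPlusCorr Ω δ ![a, b] / meshIsingPlusCorr Ω δ ![a, aε] *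
      (meshIsingFreeDualCorr (ball (0 : ℂ) 1) (δ / R) (nearestSite (δ / R) 0 + o₁)
          (nearestSite (δ / R) (yL (δ / R)) + o₂) /
          meshIsingPlusCorr (ball (0 : ℂ) 1) (δ / R) ![0, yL (δ / R)] *
        (meshIsingPlusCorr (ball (0 : ℂ) 1) (δ / R) ![0, yL (δ / R)] /
          meshIsingPlusCorr (ball (0 : ℂ) 1) (δ / R) ![0, pR]))) (𝓝[>] 0)
      (𝓝 (M / L3 * (β₁ * (L1 / L2)))) :=
    gF1.mul (gβ1.mul gDL)
  have gQ : Tendsto (fun δ => (meshIsingPlusCorr (ball (0 : ℂ) 1) (δ / R) ![0, pL (δ / R)] /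
        meshIsingPlusCorr (ball (0 : ℂ) 1) (δ / R) ![0, pR])⁻¹ *
      (meshIsingFreeDualCorr (ball (0 : ℂ) 1) (δ / R) (nearestSite (δ / R) 0 + o₁)
          (nearestSite (δ / R) (pL (δ / R)) + o₂) /
        meshIsingPlusCorr (ball (0 : ℂ) 1) (δ / R) ![0, pL (δ / R)])⁻¹) (𝓝[>] 0) (𝓝 β₂⁻¹) := by
    have h := (gPL.inv₀ one_ne_zero).mul (gβ2.inv₀ hβ2pos.ne')
    rwa [inv_one, one_mul] at h
  have ghi : Tendsto (fun δ => meshIsingPlusCorr Ω δ ![a, b] / meshIsingPlusCorr Ω δ ![a, aε] *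
      (meshIsingFreeDualCorr Ω δ (nearestSite δ a + o₁) (nearestSite δ aε + o₂) /
          meshIsingPlusCorr Ω δ ![a, aε])⁻¹ *
      (meshIsingPlusCorr (ball (0 : ℂ) 1) (δ / R) ![0, yU (δ / R)] /
          meshIsingPlusCorr (ball (0 : ℂ) 1) (δ / R) ![0, pR] *
        ((meshIsingPlusCorr (ball (0 : ℂ) 1) (δ / R) ![0, pL (δ / R)] /
            meshIsingPlusCorr (ball (0 : ℂ) 1) (δ / R) ![0, pR])⁻¹ *
          (meshIsingFreeDualCorr (ball (0 : ℂ) 1) (δ / R) (nearestSite (δ / R) 0 + o₁)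
              (nearestSite (δ / R) (pL (δ / R)) + o₂) /
            meshIsingPlusCorr (ball (0 : ℂ) 1) (δ / R) ![0, pL (δ / R)])⁻¹))) (𝓝[>] 0)
      (𝓝 (M / L3 * βΩ⁻¹ * (L1 / L2 * β₂⁻¹))) :=
    (gF1.mul (gX.inv₀ hβΩpos.ne')).mul (gDU.mul gQ)
  -- the three continuum quantities pinned by (2.23): `Aᵢ ∈ (1 - τ, 1 + τ)`
  have hA1' : 1 - τ < L1 * ‖y₀ - 0‖ ^ ((1 : ℝ) / 4) ∧ L1 * ‖y₀ - 0‖ ^ ((1 : ℝ) / 4) < 1 + τ := by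
    rw [Real.dist_eq, abs_sub_lt_iff] at hA1
    constructor <;> linarith [hA1.1, hA1.2]
  have hA2' : 1 - τ < L2 * ‖pR - 0‖ ^ ((1 : ℝ) / 4) ∧ L2 * ‖pR - 0‖ ^ ((1 : ℝ) / 4) < 1 + τ := by
    rw [Real.dist_eq, abs_sub_lt_iff] at hA2
    constructor <;> linarith [hA2.1, hA2.2]
  have hA3' : 1 - τ < L3 * ‖aε - a‖ ^ ((1 : ℝ) / 4) ∧ L3 * ‖aε - a‖ ^ ((1 : ℝ) / 4) < 1 + τ := by
    rw [Real.dist_eq, abs_sub_lt_iff] at hA3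
    constructor <;> linarith [hA3.1, hA3.2]
  set A1 := L1 * ‖y₀ - 0‖ ^ ((1 : ℝ) / 4) with hA1_def
  set A2 := L2 * ‖pR - 0‖ ^ ((1 : ℝ) / 4) with hA2_def
  set A3 := L3 * ‖aε - a‖ ^ ((1 : ℝ) / 4) with hA3_def
  have hA1pos : 0 < A1 := by linarith [hA1'.1]
  have hA2pos : 0 < A2 := by linarith [hA2'.1]
  have hA3pos : 0 < A3 := by linarith [hA3'.1]
  have hn1 : ‖y₀ - 0‖ ^ ((1 : ℝ) / 4) = ε ^ ((1 : ℝ) / 4) * R⁻¹ ^ ((1 : ℝ) / 4) := by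
    rw [sub_zero, hy₀_def, norm_div, Complex.norm_real, Complex.norm_real, Real.norm_eq_abs,
      Real.norm_eq_abs, abs_of_pos hε0, abs_of_pos hR0, div_eq_mul_inv,
      Real.mul_rpow hε0.le (inv_nonneg.2 hR0.le)]
  have hn2 : ‖pR - 0‖ ^ ((1 : ℝ) / 4) = R⁻¹ ^ ((1 : ℝ) / 4) := by
    rw [sub_zero, hpR_def, norm_div, norm_pOne_CHI, Complex.norm_real, Real.norm_eq_abs,
      abs_of_pos hR0, one_div]
  have hn3 : ‖aε - a‖ ^ ((1 : ℝ) / 4) = ε ^ ((1 : ℝ) / 4) := by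
    rw [haε_def, add_sub_cancel_left, Complex.norm_real, Real.norm_eq_abs, abs_of_pos hε0]
  have hr4 : R⁻¹ ^ ((1 : ℝ) / 4) ≠ 0 := (Real.rpow_pos_of_pos (inv_pos.2 hR0) _).ne'
  have hε4 : ε ^ ((1 : ℝ) / 4) ≠ 0 := (Real.rpow_pos_of_pos hε0 _).ne'
  have hL1ne : L1 ≠ 0 := hL1.ne'
  have hL2ne : L2 ≠ 0 := hL2.ne'
  have hL3ne : L3 ≠ 0 := hL3.ne'
  have hkey : M / L3 * (L1 / L2) = M * A1 / (A2 * A3) := by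
    rw [hA1_def, hA2_def, hA3_def, hn1, hn2, hn3]
    field_simp
  have hlo_val : M - e / 2 < M / L3 * (β₁ * (L1 / L2)) := by
    have h1 : M / L3 * (β₁ * (L1 / L2)) = M * (A1 * β₁ / (A2 * A3)) := by
      calc M / L3 * (β₁ * (L1 / L2)) = M / L3 * (L1 / L2) * β₁ := by ring
        _ = M * A1 / (A2 * A3) * β₁ := by rw [hkey]
        _ = M * (A1 * β₁ / (A2 * A3)) := by ring
    have hA23 : A2 * A3 < (1 + τ) ^ 2 :=
      calc A2 * A3 < (1 + τ) * A3 := mul_lt_mul_of_pos_right hA2'.2 hA3pos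
        _ ≤ (1 + τ) * (1 + τ) := mul_le_mul_of_nonneg_left hA3'.2.le (by linarith)
        _ = (1 + τ) ^ 2 := by ring
    have hAβ : (1 - τ) ^ 2 ≤ A1 * β₁ := by
      rw [sq]
      exact mul_le_mul hA1'.1.le hβ1.le h1τ.le hA1pos.le
    have h2 : (1 - τ) ^ 2 / (1 + τ) ^ 2 < A1 * β₁ / (A2 * A3) := by
      rw [div_lt_div_iff₀ (by positivity) (by positivity)]
      calc (1 - τ) ^ 2 * (A2 * A3) < (1 - τ) ^ 2 * (1 + τ) ^ 2 :=
            mul_lt_mul_of_pos_left hA23 (by positivity)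
        _ ≤ A1 * β₁ * (1 + τ) ^ 2 := mul_le_mul_of_nonneg_right hAβ (by positivity)
    rw [h1]
    exact hτlo.trans (mul_lt_mul_of_pos_left h2 hM0)
  have hhi_val : M / L3 * βΩ⁻¹ * (L1 / L2 * β₂⁻¹) < M + e / 2 := by
    have h1 : M / L3 * βΩ⁻¹ * (L1 / L2 * β₂⁻¹) = M * (A1 / (A2 * A3 * βΩ * β₂)) := by
      calc M / L3 * βΩ⁻¹ * (L1 / L2 * β₂⁻¹) = M / L3 * (L1 / L2) * (βΩ⁻¹ * β₂⁻¹) := by ring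
        _ = M * A1 / (A2 * A3) * (βΩ⁻¹ * β₂⁻¹) := by rw [hkey]
        _ = M * (A1 / (A2 * A3 * βΩ * β₂)) := by ring
    have h12 : (1 - τ) * (1 - τ) ≤ A2 * A3 := mul_le_mul hA2'.1.le hA3'.1.le h1τ.le hA2pos.le
    have h34 : (1 - τ) * (1 - τ) ≤ βΩ * β₂ := mul_le_mul hβΩ.le hβ2.le h1τ.le hβΩpos.le
    have hprod : (1 - τ) ^ 4 ≤ A2 * A3 * βΩ * β₂ :=
      calc (1 - τ) ^ 4 = (1 - τ) * (1 - τ) * ((1 - τ) * (1 - τ)) := by ring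
        _ ≤ A2 * A3 * (βΩ * β₂) := mul_le_mul h12 h34 (by positivity) (by positivity)
        _ = A2 * A3 * βΩ * β₂ := by ring
    have hPpos : 0 < A2 * A3 * βΩ * β₂ := by positivity
    have h2 : A1 / (A2 * A3 * βΩ * β₂) < (1 + τ) / (1 - τ) ^ 4 := by
      rw [div_lt_div_iff₀ hPpos (by positivity)]
      calc A1 * (1 - τ) ^ 4 ≤ A1 * (A2 * A3 * βΩ * β₂) := mul_le_mul_of_nonneg_left hprod hA1pos.le
        _ < (1 + τ) * (A2 * A3 * βΩ * β₂) := mul_lt_mul_of_pos_right hA1'.2 hPpos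
    rw [h1]
    exact (mul_lt_mul_of_pos_left h2 hM0).trans hτhi
  /- Step 9: conclusion. -/
  have ev_lo := glo.eventually_const_lt (show M - e < M / L3 * (β₁ * (L1 / L2)) by linarith)
  have ev_hi := ghi.eventually_lt_const (show M / L3 * βΩ⁻¹ * (L1 / L2 * β₂⁻¹) < M + e by linarith)
  filter_upwards [main, ev_lo, ev_hi] with δ hmain hlo hhi
  rw [Real.dist_eq, abs_sub_lt_iff]
  constructor <;> linarith [hmain.1, hmain.2]


/-- **CHI Theorem 1.1 (free boundary conditions) for CHI's own family of VERTEX domains**, one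
domain, one marked point fixed and one moving with the mesh: under the hypotheses of
`tendsto_twoPoint_plus_rho_of_mixed`, `𝔼^free_{Ω•_δ}[σ_{[a/δ]+o₁}σ_{[y_δ/δ]+o₂}] / ϱ(δ) →
⟨σ_aσ_{y₀}⟩^free_Ω` — CHI p. 19: "`𝔼^free_{Ω•_δ-δ}[σ_aσ_b] ∼ 𝓑_Ω(a;b) 𝔼⁺_{Ω_δ}[σ_aσ_b] ∼
ϱ(δ) 𝓑_Ω(a;b)⟨σ_aσ_b⟩⁺_Ω = ϱ(δ)⟨σ_aσ_b⟩^free_Ω`".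
[cite: ChelkakHonglerIzyurovAnnals2015, §2.9 p. 19 (proof of Thm. 1.1, free boundary conditions); Thm. 1.7] -/
theorem tendsto_twoPoint_freeDual_rho_of_mixed (o₁ o₂ : Site 2) {Ω : Set ℂ} (hΩ : IsAdmissibleDomain Ω)
    (hM : MeshApproximates Ω) {φ : ℂ → ℂ}
    (hφ : IsConformalBijection φ Ω UpperHalfPlane.upperHalfPlaneSet) {c : ℂ → ℂ}
    (hc : IsConformalBijection c (ball (0 : ℂ) 1) UpperHalfPlane.upperHalfPlaneSet)
    (hR : ∀ x ∈ Ω, ∀ (y : ℝ → ℂ) (y₀ y' : ℂ), y₀ ∈ Ω → y' ∈ Ω → y₀ ≠ x → y' ≠ x →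
      Tendsto y (𝓝[>] 0) (𝓝 y₀) →
        Tendsto (fun δ => meshIsingPlusCorr Ω δ ![x, y δ] / meshIsingPlusCorr Ω δ ![x, y'])
          (𝓝[>] 0) (𝓝 (twoPointPlusCHI φ x y₀ / twoPointPlusCHI φ x y')))
    (hB : ∀ x ∈ Ω, ∀ (y : ℝ → ℂ) (y₀ : ℂ), y₀ ∈ Ω → y₀ ≠ x → Tendsto y (𝓝[>] 0) (𝓝 y₀) →
        Tendsto (fun δ => meshIsingFreeDualCorr Ω δ (nearestSite δ x + o₁) (nearestSite δ (y δ) + o₂) /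
            meshIsingPlusCorr Ω δ ![x, y δ]) (𝓝[>] 0) (𝓝 (bCHI (φ x) (φ y₀))))
    (hRD : ∀ x ∈ ball (0 : ℂ) 1, ∀ (y : ℝ → ℂ) (y₀ y' : ℂ), y₀ ∈ ball (0 : ℂ) 1 →
      y' ∈ ball (0 : ℂ) 1 → y₀ ≠ x → y' ≠ x → Tendsto y (𝓝[>] 0) (𝓝 y₀) →
        Tendsto (fun δ => meshIsingPlusCorr (ball (0 : ℂ) 1) δ ![x, y δ] /
            meshIsingPlusCorr (ball (0 : ℂ) 1) δ ![x, y'])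
          (𝓝[>] 0) (𝓝 (twoPointPlusCHI c x y₀ / twoPointPlusCHI c x y')))
    (hBD : ∀ x ∈ ball (0 : ℂ) 1, ∀ (y : ℝ → ℂ) (y₀ : ℂ), y₀ ∈ ball (0 : ℂ) 1 → y₀ ≠ x →
      Tendsto y (𝓝[>] 0) (𝓝 y₀) →
        Tendsto (fun δ => meshIsingFreeDualCorr (ball (0 : ℂ) 1) δ (nearestSite δ x + o₁)
            (nearestSite δ (y δ) + o₂) / meshIsingPlusCorr (ball (0 : ℂ) 1) δ ![x, y δ])
          (𝓝[>] 0) (𝓝 (bCHI (c x) (c y₀))))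
    {a : ℂ} (ha : a ∈ Ω) {y : ℝ → ℂ} {y₀ : ℂ} (hy₀ : y₀ ∈ Ω) (hy₀a : y₀ ≠ a)
    (hy : Tendsto y (𝓝[>] 0) (𝓝 y₀)) :
    Tendsto (fun δ => meshIsingFreeDualCorr Ω δ (nearestSite δ a + o₁) (nearestSite δ (y δ) + o₂) / rhoCHI δ)
      (𝓝[>] 0) (𝓝 (twoPointFreeCHI φ a y₀)) := by
  have hP := tendsto_twoPoint_plus_rho_of_mixed o₁ o₂ hΩ hM hφ hc hR hB hRD hBD ha hy₀ hy₀a.symm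
  have hL : 0 < twoPointPlusCHI φ a y₀ := twoPointPlusCHI_pos' hΩ.1 hφ ha hy₀ hy₀a.symm
  have hQ : Tendsto (fun δ => meshIsingPlusCorr Ω δ ![a, y δ] / meshIsingPlusCorr Ω δ ![a, y₀]) (𝓝[>] 0) (𝓝 1) := by
    have h := hR a ha y y₀ y₀ hy₀ hy₀ hy₀a hy₀a hy
    rwa [div_self hL.ne'] at h
  have hF := hB a ha y y₀ hy₀ hy₀a hy
  have hφa : 0 < (φ a).im := hφ.2.mapsTo ha
  have hφb : 0 < (φ y₀).im := hφ.2.mapsTo hy₀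
  have hw1 : φ y₀ ≠ φ a := fun h => hy₀a (hφ.2.injOn hy₀ ha h)
  have hw2 : φ y₀ ≠ (starRingEnd ℂ) (φ a) := fun h => by
    have h' := congrArg Complex.im h
    rw [Complex.conj_im] at h'
    linarith
  rw [twoPointFreeCHI_eq_mul_bCHI hw1 hw2]
  have hlim := (hF.mul hQ).mul hP
  rw [mul_one, mul_comm] at hlim
  refine hlim.congr' ?_
  filter_upwards [eventually_nearestSite_ne_of_tendsto hy₀a hy, eventually_nearestSite_ne hy₀a.symm] with δ hne hne'
  have hpos : 0 < meshIsingPlusCorr Ω δ ![a, y δ] :=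
    lt_of_lt_of_le (twoPointPlus_pos criticalBetaTwo_pos _) (twoPointPlus_le_meshIsingPlusCorr_two Ω δ hne)
  have hpos' : 0 < meshIsingPlusCorr Ω δ ![a, y₀] :=
    lt_of_lt_of_le (twoPointPlus_pos criticalBetaTwo_pos _) (twoPointPlus_le_meshIsingPlusCorr_two Ω δ hne')
  field_simp

/-! ### All admissible approximable domains: CHI Thm 1.1 (`+`, faces) and (free, vertices) from
CHI Thm 1.5 (`k = 1`), Remark 2.18 and Thm 1.7 as printed -/

/-- **CHI Theorem 1.1, `+` boundary conditions (faces), for every admissible approximable domain,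
from Thm 1.5 (`k = 1`, `h₁`), Remark 2.18 (`h₂`) — the bodies of the named facts
`chi_plusTwoPoint_diagLogDerivative`, `chi_plusTwoPoint_nnRatio` — and Thm 1.7 in its PRINTED mixed
form (`hM`).** The ratio limits (Prop 2.20) come from `h₁, h₂` by
`tendsto_meshIsingPlusCorr_ratio_of_spinorCoefficient`; the comparison domain is the unit disc
(`meshApproximates_ball`, inverse Cayley chart). [cite: ChelkakHonglerIzyurovAnnals2015, Thm. 1.1 (+ boundary conditions), §2.9; Thm. 1.5, Remark 2.18, Thm. 1.7] -/
theorem chi_twoPoint_plus_rho_of_mixed (o₁ o₂ : Site 2)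
    (h₁ : ∀ (Ω : Set ℂ), IsAdmissibleDomain Ω → MeshApproximates Ω → ∀ (φ : ℂ → ℂ),
      IsConformalBijection φ Ω UpperHalfPlane.upperHalfPlaneSet → ∀ x ∈ Ω,
        ∀ K ⊆ Ω \ {x}, IsCompact K → ∀ s ∈ LatticeRatio.diagSteps, ∀ ε > (0 : ℝ), ∀ᶠ δ in 𝓝[>] (0 : ℝ),
          ∀ v : Site 2, meshPoint δ v ∈ K →
            |(meshIsingPlusCorr Ω δ ![x, meshPoint δ (v + s)] / meshIsingPlusCorr Ω δ ![x, meshPoint δ v] - 1) / δ -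
              (ACHI φ (meshPoint δ v) x * Site.toComplex s).re| < ε)
    (h₂ : ∀ (Ω : Set ℂ), IsAdmissibleDomain Ω → MeshApproximates Ω → ∀ (φ : ℂ → ℂ),
      IsConformalBijection φ Ω UpperHalfPlane.upperHalfPlaneSet → ∀ x ∈ Ω,
        ∀ K ⊆ Ω \ {x}, IsCompact K → ∀ s ∈ LatticeRatio.nnSteps, ∀ ε > (0 : ℝ), ∀ᶠ δ in 𝓝[>] (0 : ℝ),
          ∀ v : Site 2, meshPoint δ v ∈ K →
            |meshIsingPlusCorr Ω δ ![x, meshPoint δ (v + s)] / meshIsingPlusCorr Ω δ ![x, meshPoint δ v] - 1| < ε)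
    (hM : ∀ (Ω : Set ℂ), IsAdmissibleDomain Ω → MeshApproximates Ω → ∀ (φ : ℂ → ℂ),
      IsConformalBijection φ Ω UpperHalfPlane.upperHalfPlaneSet →
        ∀ x ∈ Ω, ∀ (y : ℝ → ℂ) (y₀ : ℂ), y₀ ∈ Ω → y₀ ≠ x → Tendsto y (𝓝[>] 0) (𝓝 y₀) →
          Tendsto (fun δ => meshIsingFreeDualCorr Ω δ (nearestSite δ x + o₁) (nearestSite δ (y δ) + o₂) /
              meshIsingPlusCorr Ω δ ![x, y δ]) (𝓝[>] 0) (𝓝 (bCHI (φ x) (φ y₀)))) :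
    ∀ (Ω : Set ℂ), IsAdmissibleDomain Ω → MeshApproximates Ω → ∀ (φ : ℂ → ℂ),
      IsConformalBijection φ Ω UpperHalfPlane.upperHalfPlaneSet → ∀ x ∈ Ω, ∀ y ∈ Ω, x ≠ y →
        Tendsto (fun δ => meshIsingPlusCorr Ω δ ![x, y] / rhoCHI δ) (𝓝[>] 0)
          (𝓝 (twoPointPlusCHI φ x y)) := by
  intro Ω hΩ hMΩ φ hφ x hx y hy hxy
  have hD := SlitDisc.isAdmissibleDomain_ball
  have hc := SlitDisc.isConformalBijection_cayleyInvFun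
  exact tendsto_twoPoint_plus_rho_of_mixed o₁ o₂ hΩ hMΩ hφ hc
    (fun x hx y y₀ y' hy₀ hy' hy₀x hy'x hy =>
      tendsto_meshIsingPlusCorr_ratio_of_spinorCoefficient hΩ hφ hx (h₁ Ω hΩ hMΩ φ hφ x hx)
        (h₂ Ω hΩ hMΩ φ hφ x hx) y hy₀ hy' hy₀x hy'x hy)
    (hM Ω hΩ hMΩ φ hφ)
    (fun x hx y y₀ y' hy₀ hy' hy₀x hy'x hy =>
      tendsto_meshIsingPlusCorr_ratio_of_spinorCoefficient hD hc hx (h₁ _ hD meshApproximates_ball _ hc x hx)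
        (h₂ _ hD meshApproximates_ball _ hc x hx) y hy₀ hy' hy₀x hy'x hy)
    (hM _ hD meshApproximates_ball _ hc) hx hy hxy

/-- **CHI Theorem 1.1, free boundary conditions, for CHI's family of VERTEX domains `Ω•_δ` of every
admissible approximable domain** (one marked point moving with the mesh), from Thm 1.5 (`k = 1`),
Remark 2.18 and Thm 1.7 as printed: `𝔼^free_{Ω•_δ}[σ_{[x/δ]+o₁}σ_{[y_δ/δ]+o₂}] / ϱ(δ) →
⟨σ_xσ_{y₀}⟩^free_Ω`. [cite: ChelkakHonglerIzyurovAnnals2015, Thm. 1.1 (free boundary conditions), §2.9 p. 19; Thm. 1.5, Remark 2.18, Thm. 1.7] -/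
theorem chi_twoPoint_freeDual_rho_of_mixed (o₁ o₂ : Site 2)
    (h₁ : ∀ (Ω : Set ℂ), IsAdmissibleDomain Ω → MeshApproximates Ω → ∀ (φ : ℂ → ℂ),
      IsConformalBijection φ Ω UpperHalfPlane.upperHalfPlaneSet → ∀ x ∈ Ω,
        ∀ K ⊆ Ω \ {x}, IsCompact K → ∀ s ∈ LatticeRatio.diagSteps, ∀ ε > (0 : ℝ), ∀ᶠ δ in 𝓝[>] (0 : ℝ),
          ∀ v : Site 2, meshPoint δ v ∈ K →
            |(meshIsingPlusCorr Ω δ ![x, meshPoint δ (v + s)] / meshIsingPlusCorr Ω δ ![x, meshPoint δ v] - 1) / δ -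
              (ACHI φ (meshPoint δ v) x * Site.toComplex s).re| < ε)
    (h₂ : ∀ (Ω : Set ℂ), IsAdmissibleDomain Ω → MeshApproximates Ω → ∀ (φ : ℂ → ℂ),
      IsConformalBijection φ Ω UpperHalfPlane.upperHalfPlaneSet → ∀ x ∈ Ω,
        ∀ K ⊆ Ω \ {x}, IsCompact K → ∀ s ∈ LatticeRatio.nnSteps, ∀ ε > (0 : ℝ), ∀ᶠ δ in 𝓝[>] (0 : ℝ),
          ∀ v : Site 2, meshPoint δ v ∈ K →
            |meshIsingPlusCorr Ω δ ![x, meshPoint δ (v + s)] / meshIsingPlusCorr Ω δ ![x, meshPoint δ v] - 1| < ε)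
    (hM : ∀ (Ω : Set ℂ), IsAdmissibleDomain Ω → MeshApproximates Ω → ∀ (φ : ℂ → ℂ),
      IsConformalBijection φ Ω UpperHalfPlane.upperHalfPlaneSet →
        ∀ x ∈ Ω, ∀ (y : ℝ → ℂ) (y₀ : ℂ), y₀ ∈ Ω → y₀ ≠ x → Tendsto y (𝓝[>] 0) (𝓝 y₀) →
          Tendsto (fun δ => meshIsingFreeDualCorr Ω δ (nearestSite δ x + o₁) (nearestSite δ (y δ) + o₂) /
              meshIsingPlusCorr Ω δ ![x, y δ]) (𝓝[>] 0) (𝓝 (bCHI (φ x) (φ y₀)))) :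
    ∀ (Ω : Set ℂ), IsAdmissibleDomain Ω → MeshApproximates Ω → ∀ (φ : ℂ → ℂ),
      IsConformalBijection φ Ω UpperHalfPlane.upperHalfPlaneSet → ∀ x ∈ Ω,
        ∀ (y : ℝ → ℂ) (y₀ : ℂ), y₀ ∈ Ω → y₀ ≠ x → Tendsto y (𝓝[>] 0) (𝓝 y₀) →
          Tendsto (fun δ => meshIsingFreeDualCorr Ω δ (nearestSite δ x + o₁) (nearestSite δ (y δ) + o₂) / rhoCHI δ)
            (𝓝[>] 0) (𝓝 (twoPointFreeCHI φ x y₀)) := by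
  intro Ω hΩ hMΩ φ hφ x hx y y₀ hy₀ hy₀x hy
  have hD := SlitDisc.isAdmissibleDomain_ball
  have hc := SlitDisc.isConformalBijection_cayleyInvFun
  exact tendsto_twoPoint_freeDual_rho_of_mixed o₁ o₂ hΩ hMΩ hφ hc
    (fun x hx y y₀ y' hy₀ hy' hy₀x hy'x hy =>
      tendsto_meshIsingPlusCorr_ratio_of_spinorCoefficient hΩ hφ hx (h₁ Ω hΩ hMΩ φ hφ x hx)
        (h₂ Ω hΩ hMΩ φ hφ x hx) y hy₀ hy' hy₀x hy'x hy)
    (hM Ω hΩ hMΩ φ hφ)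
    (fun x hx y y₀ y' hy₀ hy' hy₀x hy'x hy =>
      tendsto_meshIsingPlusCorr_ratio_of_spinorCoefficient hD hc hx (h₁ _ hD meshApproximates_ball _ hc x hx)
        (h₂ _ hD meshApproximates_ball _ hc x hx) y hy₀ hy' hy₀x hy'x hy)
    (hM _ hD meshApproximates_ball _ hc) hx hy₀ hy₀x hy

/-! ### The Griffiths sandwich with translated vertex domains of the approximants -/

/-- The translate of the dual graph is a subgraph of `ℤ²`. [folklore] -/
theorem map_kwDual_le_zdGraph (Λ : Finset (Site 2)) (k : Site 2) :
    (kwDual Λ).map (Site.shift k).toEmbedding ≤ zdGraph 2 := by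
  intro u v huv
  rw [SimpleGraph.map_adj] at huv
  obtain ⟨u', v', h', rfl, rfl⟩ := huv
  exact (zdGraph_adj_shift_iff k u' v').2 (kwDual_le h')

/-- The translate of the dual graph is locally finite (a subgraph of `ℤ²`). [folklore] -/
instance instLocallyFiniteMapKwDual (Λ : Finset (Site 2)) (k : Site 2) :
    ((kwDual Λ).map (Site.shift k).toEmbedding).LocallyFinite := fun x =>
  (((zdGraph 2).neighborSet x).toFinite.subset
    (SimpleGraph.neighborSet_mono (map_kwDual_le_zdGraph Λ k) x)).fintype

/-- **Translation of the vertex model**: translating the dual volume, its graph and the marked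
dual sites by `k` does not change the free correlation. [cite: FriedliVelenik2017, Exercise 3.14] -/
theorem isingCorr_map_kwDual_shift (Λ : Finset (Site 2)) (k : Site 2) (A : Finset (Site 2)) :
    isingCorr ((kwDual Λ).map (Site.shift k).toEmbedding) ((dualSites Λ).map (Site.shift k).toEmbedding)
        criticalBetaTwo 0 .free (A.map (Site.shift k).toEmbedding) =
      isingCorr (kwDual Λ) (dualSites Λ) criticalBetaTwo 0 .free A :=
  isingCorr_free_map (G := kwDual Λ) (G' := (kwDual Λ).map (Site.shift k).toEmbedding)
    (Site.shift k).toEmbedding (fun _ _ _ _ => SimpleGraph.map_adj_apply) criticalBetaTwo 0 A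

/-- Corners of a plaquette are within `2δ` of its label (in the mesh). [folklore] -/
theorem dist_meshPoint_add_cornerOff_le {δ : ℝ} (hδ : 0 ≤ δ) (p : Site 2) (j : Fin 4) :
    dist (meshPoint δ p) (meshPoint δ (p + cornerOff j)) ≤ 2 * δ := by
  rw [Complex.dist_eq]
  refine (Complex.norm_le_abs_re_add_abs_im _).trans ?_
  rw [Complex.sub_re, Complex.sub_im, meshPoint_re, meshPoint_re, meshPoint_im, meshPoint_im]
  fin_cases j <;> simp [cornerOff, mul_add, abs_of_nonneg hδ] <;> linarith

/-- Dual sites of `Λ` are within one diagonal step of a site of `Λ`: `dist(δp, δx) ≤ 2δ` for some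
`x ∈ Λ`. [folklore] -/
theorem exists_mem_dist_le_of_mem_dualSites {Λ : Finset (Site 2)} {p : Site 2} (hp : p ∈ dualSites Λ)
    {δ : ℝ} (hδ : 0 ≤ δ) : ∃ x ∈ Λ, dist (meshPoint δ p) (meshPoint δ x) ≤ 2 * δ := by
  obtain ⟨j, hj⟩ := mem_dualSites.1 hp
  rw [mem_edgesTouching_iff] at hj
  obtain ⟨-, x, hx, hxe⟩ := hj
  refine ⟨x, hx, ?_⟩
  rw [plaqSide, Sym2.mem_iff] at hxe
  rcases hxe with rfl | rfl
  · exact dist_meshPoint_add_cornerOff_le hδ p j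
  · rw [add_assoc, ← show cornerOff (j + 1) = cornerOff j + cornerUnit j by
      rw [cornerUnit_eq_off_sub, add_sub_cancel]]
    exact dist_meshPoint_add_cornerOff_le hδ p (j + 1)

/-- **Adjacent plaquettes over a site of `Λ` are joined in the dual graph**, east: if `P + e₀ ∈ Λ`
then `P ∼ P + e₀` in `kwDual Λ` (the vertical primal bond `{P + e₀, P + e₀ + e₁}` touches `Λ` and
is crossed by the dual bond `{P, P + e₀}`). [folklore] -/
theorem kwDual_adj_add_single_zero {Λ : Finset (Site 2)} {P : Site 2} (h : P + Pi.single 0 1 ∈ Λ) :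
    (kwDual Λ).Adj P (P + Pi.single 0 1) := by
  rw [kwDual_adj, mem_dualBonds]
  refine ⟨s(P + Pi.single 0 1, P + Pi.single 0 1 + Pi.single 1 1), ?_, ?_⟩
  · rw [mem_edgesTouching_iff]
    refine ⟨?_, P + Pi.single 0 1, h, Sym2.mem_mk_left _ _⟩
    rw [SimpleGraph.mem_edgeSet]
    exact (zdGraph_adj_iff _ _).2 ⟨1, Or.inl rfl⟩
  · rw [Literature.Probability.Percolation.dualEdge_vertical, add_sub_cancel_right]

/-- **Adjacent plaquettes over a site of `Λ` are joined in the dual graph**, north: if `P + e₁ ∈ Λ`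
then `P ∼ P + e₁` in `kwDual Λ` (across the horizontal primal bond `{P + e₁, P + e₁ + e₀}`).
[folklore] -/
theorem kwDual_adj_add_single_one {Λ : Finset (Site 2)} {P : Site 2} (h : P + Pi.single 1 1 ∈ Λ) :
    (kwDual Λ).Adj P (P + Pi.single 1 1) := by
  rw [kwDual_adj, mem_dualBonds]
  refine ⟨s(P + Pi.single 1 1, P + Pi.single 1 1 + Pi.single 0 1), ?_, ?_⟩
  · rw [mem_edgesTouching_iff]
    refine ⟨?_, P + Pi.single 1 1, h, Sym2.mem_mk_left _ _⟩
    rw [SimpleGraph.mem_edgeSet]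
    exact (zdGraph_adj_iff _ _).2 ⟨0, Or.inl rfl⟩
  · rw [Literature.Probability.Percolation.dualEdge_horizontal, add_sub_cancel_right]

/-- **`ℤ²`-adjacent plaquettes both of which are sites of `Λ` are joined in the dual graph.**
[folklore] -/
theorem kwDual_adj_of_adj_of_mem {Λ : Finset (Site 2)} {P Q : Site 2} (hPQ : (zdGraph 2).Adj P Q)
    (hP : P ∈ Λ) (hQ : Q ∈ Λ) : (kwDual Λ).Adj P Q := by
  obtain ⟨i, rfl | rfl⟩ := (zdGraph_adj_iff P Q).1 hPQ
  · fin_cases i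
    · exact kwDual_adj_add_single_zero hQ
    · exact kwDual_adj_add_single_one hQ
  · fin_cases i
    · exact (kwDual_adj_add_single_zero hP).symm
    · exact (kwDual_adj_add_single_one hP).symm

/-- A compact subset of an open set has a compact closed thickening inside it, with a positive
radius. [folklore] -/
theorem exists_cthickening_subset {K U : Set ℂ} (hK : IsCompact K) (hU : IsOpen U) (hKU : K ⊆ U) :
    ∃ r : ℝ, 0 < r ∧ cthickening r K ⊆ U ∧ IsCompact (cthickening r K) := by
  obtain ⟨r, hr, hrU⟩ := hK.exists_cthickening_subset_open hU hKU
  exact ⟨r, hr, hrU, hK.cthickening⟩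

/-- The marked pair as a translate. [folklore] -/
theorem pair_eq_map_shift_neg (x y k : Site 2) :
    ({x, y} : Finset (Site 2)) = ({x + k, y + k} : Finset (Site 2)).map (Site.shift (-k)).toEmbedding := by
  simp [Finset.map_insert, Site.shift_apply]

/-- **Lower lattice sandwich with the translated vertex domain of an inner approximant.** For `Ω`
Jordan, an inner open `Ω₀` (`closure Ω₀ ⊆ Ω`, `MeshApproximates Ω₀`), distinct `z, w ∈ Ω₀` and a
lattice vector `k`, eventually
`𝔼^free_{(Ω₀)•_δ}[σ_{[z/δ]+k}σ_{[w/δ]+k}] ≤ 𝔼^free_{Ω_δ, all sites}[σ_{[z/δ]}σ_{[w/δ]}]`: translate the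
vertex model by `-k` (an exact symmetry), then enlarge volume and couplings (Griffiths): the
translated dual sites and dual bonds lie within `O(δ)` of `Ω₀ ⋐ Ω`, hence inside the bulk component
of `Ω_δ` with their bonds (`JordanDomain.eventually_forall_mem_meshDomain'`).
[cite: FriedliVelenik2017, Exercises 3.12, 3.14 and 3.31; ChelkakHonglerIzyurovAnnals2015, §2.9 p. 19] -/
theorem eventually_freeDual_inner_le (Ω : JordanDomain) {Ω₀ : Set ℂ} (hΩ₀o : IsOpen Ω₀)
    (hM₀ : MeshApproximates Ω₀) (h₀ : closure Ω₀ ⊆ Ω.carrier) {z w : ℂ} (hz : z ∈ Ω₀) (hw : w ∈ Ω₀)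
    (hzw : z ≠ w) (k : Site 2) :
    ∀ᶠ δ in 𝓝[>] (0 : ℝ), meshIsingFreeDualCorr Ω₀ δ (nearestSite δ z + k) (nearestSite δ w + k) ≤
      isingTwoPoint (discreteDomainGraph Ω.carrier δ) (meshDomainFinset Ω.carrier δ) criticalBetaTwo 0
        BoundaryCondition.free (nearestSite δ z) (nearestSite δ w) := by
  have hb₀ : Bornology.IsBounded Ω₀ := Ω.isBounded.subset (subset_closure.trans h₀)
  obtain ⟨r, hr, hrΩ, hKc⟩ := exists_cthickening_subset hb₀.isCompact_closure Ω.isOpen h₀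
  set C : ℝ := |((k 0 : ℤ) : ℝ)| + |((k 1 : ℤ) : ℝ)| + 3 with hC
  have hsmall : ∀ᶠ δ in 𝓝[>] (0 : ℝ), δ * C ≤ r := by
    have h : Tendsto (fun δ : ℝ => δ * C) (𝓝 0) (𝓝 (0 * C)) := tendsto_id.mul_const C
    rw [zero_mul] at h
    exact mem_nhdsWithin_of_mem_nhds (h.eventually (Iic_mem_nhds hr))
  filter_upwards [Ω.eventually_forall_mem_meshDomain' hKc hrΩ,
    eventually_nearestSite_add_mem_meshInteriorFinset hΩ₀o hM₀ hz k,
    eventually_nearestSite_add_mem_meshInteriorFinset hΩ₀o hM₀ hw k, eventually_nearestSite_ne hzw,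
    hsmall, self_mem_nhdsWithin] with δ hbulk hz' hw' hne hδC hδ
  have hδ0 : (0 : ℝ) < δ := hδ
  -- every point within `δ(C-2)` of the mesh point of a dual site of `Λ₀` lies in the thickening
  have hnear : ∀ p ∈ dualSites (meshInteriorFinset Ω₀ δ), ∀ q : ℂ, dist q (meshPoint δ p) ≤ δ * (C - 2) →
      q ∈ cthickening r (closure Ω₀) := by
    intro p hp q hq
    obtain ⟨x, hx, hpx⟩ := exists_mem_dist_le_of_mem_dualSites hp hδ0.le
    have hxΩ₀ : meshPoint δ x ∈ closure Ω₀ := by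
      have hx' : x ∈ meshDomain Ω₀ δ := by
        have := meshInteriorFinset_subset_meshDomainFinset Ω₀ δ hx
        rwa [← Finset.mem_coe, coe_meshDomainFinset hb₀ hδ0] at this
      exact subset_closure (meshDomain_subset_meshVertices Ω₀ δ hx')
    refine Metric.mem_cthickening_of_dist_le q (meshPoint δ x) r _ hxΩ₀ ?_
    calc dist q (meshPoint δ x) ≤ dist q (meshPoint δ p) + dist (meshPoint δ p) (meshPoint δ x) := dist_triangle _ _ _
      _ ≤ δ * (C - 2) + 2 * δ := add_le_add hq hpx
      _ = δ * C := by ring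
      _ ≤ r := hδC
  have hshift_dist : ∀ p : Site 2, dist (meshPoint δ (p + -k)) (meshPoint δ p) ≤ δ * (C - 3) := by
    intro p
    rw [meshPoint_add_site, dist_eq_norm, add_sub_cancel_left]
    have h := norm_meshPoint_le hδ0.le (-k)
    simp only [Pi.neg_apply, Int.cast_neg, abs_neg] at h
    rw [hC]
    linarith
  -- the translated dual sites are sites of `Ω_δ`
  have hV : ∀ p ∈ dualSites (meshInteriorFinset Ω₀ δ), p + -k ∈ meshDomain Ω.carrier δ := by
    intro p hp
    refine hbulk.1 _ (hnear p hp _ ?_)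
    have := hshift_dist p
    nlinarith
  -- the translated dual graph is a subgraph of `Ω_δ`
  have hG'le : (kwDual (meshInteriorFinset Ω₀ δ)).map (Site.shift (-k)).toEmbedding ≤
      discreteDomainGraph Ω.carrier δ := by
    intro u v huv
    rw [SimpleGraph.map_adj] at huv
    obtain ⟨u', v', h', rfl, rfl⟩ := huv
    have hu' : u' ∈ dualSites (meshInteriorFinset Ω₀ δ) :=
      mem_dualSites_of_mem_dualBonds (kwDual_adj.1 h') (Sym2.mem_mk_left _ _)
    have hv' : v' ∈ dualSites (meshInteriorFinset Ω₀ δ) :=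
      mem_dualSites_of_mem_dualBonds (kwDual_adj.1 h') (Sym2.mem_mk_right _ _)
    have hadj : (zdGraph 2).Adj (u' + -k) (v' + -k) := (zdGraph_adj_shift_iff (-k) u' v').2 (kwDual_le h')
    change (discreteDomainGraph Ω.carrier δ).Adj (u' + -k) (v' + -k)
    rw [discreteDomainGraph_adj_iff, meshGraph_adj_iff]
    refine ⟨⟨hadj, ?_⟩, hV u' hu', hV v' hv'⟩
    have hball : segment ℝ (meshPoint δ (u' + -k)) (meshPoint δ (v' + -k)) ⊆ closedBall (meshPoint δ (u' + -k)) δ :=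
      (convex_closedBall _ _).segment_subset (mem_closedBall_self hδ0.le)
        (mem_closedBall'.2 (Polyomino.dist_meshPoint_le_of_adj hδ0.le hadj))
    refine hball.trans fun q hq => subset_closure (hrΩ (hnear u' hu' q ?_))
    calc dist q (meshPoint δ u') ≤ dist q (meshPoint δ (u' + -k)) + dist (meshPoint δ (u' + -k)) (meshPoint δ u') :=
          dist_triangle _ _ _
      _ ≤ δ + δ * (C - 3) := add_le_add (mem_closedBall.1 hq) (hshift_dist u')
      _ = δ * (C - 2) := by ring
  -- translate, then enlarge the volume and the couplings
  have hAV : ({nearestSite δ z, nearestSite δ w} : Finset (Site 2)) ⊆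
      (dualSites (meshInteriorFinset Ω₀ δ)).map (Site.shift (-k)).toEmbedding := by
    rw [pair_eq_map_shift_neg _ _ k]
    exact Finset.map_subset_map.2 (Finset.insert_subset (mem_dualSites_of_mem hz')
      (Finset.singleton_subset_iff.2 (mem_dualSites_of_mem hw')))
  have hVD : (dualSites (meshInteriorFinset Ω₀ δ)).map (Site.shift (-k)).toEmbedding ⊆ meshDomainFinset Ω.carrier δ := by
    intro u hu
    rw [Finset.mem_map] at hu
    obtain ⟨p, hp, rfl⟩ := hu
    rw [← Finset.mem_coe, coe_meshDomainFinset Ω.isBounded hδ0]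
    simpa [Site.shift_apply] using hV p hp
  rw [isingTwoPoint_free_eq_isingCorr_pair _ hne, meshIsingFreeDualCorr,
    ← isingCorr_map_kwDual_shift (meshInteriorFinset Ω₀ δ) (-k), ← pair_eq_map_shift_neg _ _ k]
  calc isingCorr ((kwDual (meshInteriorFinset Ω₀ δ)).map (Site.shift (-k)).toEmbedding)
        ((dualSites (meshInteriorFinset Ω₀ δ)).map (Site.shift (-k)).toEmbedding) criticalBetaTwo 0 .free
        {nearestSite δ z, nearestSite δ w}
      ≤ isingCorr ((kwDual (meshInteriorFinset Ω₀ δ)).map (Site.shift (-k)).toEmbedding)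
        (meshDomainFinset Ω.carrier δ) criticalBetaTwo 0 .free {nearestSite δ z, nearestSite δ w} :=
        isingCorr_free_le_of_subset _ criticalBetaTwo_pos.le le_rfl hAV hVD
    _ ≤ isingCorr (discreteDomainGraph Ω.carrier δ) (meshDomainFinset Ω.carrier δ) criticalBetaTwo 0 .free
        {nearestSite δ z, nearestSite δ w} :=
        isingCorr_free_mono_graph (fun Λ A B β h bc => GKSInequalities.gks_two_holds _) hG'le
          criticalBetaTwo_pos.le le_rfl (hAV.trans hVD)

/-- **Upper lattice sandwich with the translated vertex domain of an outer approximant.** For `Ω`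
Jordan, an outer open `Ω' ⊇ closure Ω` with `MeshApproximates Ω'`, distinct `z, w ∈ Ω` and a
lattice vector `k`, eventually
`𝔼^free_{Ω_δ, all sites}[σ_{[z/δ]}σ_{[w/δ]}] ≤ 𝔼^free_{(Ω')•_δ}[σ_{[z/δ]+k}σ_{[w/δ]+k}]`: the sites
of `Ω_δ` translated by `k` are deep inside `Ω'`, hence free faces of `Ω'_δ` (bulk clause of
`MeshApproximates Ω'`), so they are dual sites and lattice-adjacent ones are dual-adjacent
(`kwDual_adj_of_adj_of_mem`); translate back and enlarge (Griffiths).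
[cite: FriedliVelenik2017, Exercises 3.12, 3.14 and 3.31; ChelkakHonglerIzyurovAnnals2015, §2.9 p. 19] -/
theorem eventually_le_freeDual_outer (Ω : JordanDomain) {Ω' : Set ℂ} (hM' : MeshApproximates Ω')
    (h' : closure Ω.carrier ⊆ Ω') (hΩ'o : IsOpen Ω') {z w : ℂ} (hz : z ∈ Ω.carrier) (hw : w ∈ Ω.carrier)
    (hzw : z ≠ w) (k : Site 2) :
    ∀ᶠ δ in 𝓝[>] (0 : ℝ),
      isingTwoPoint (discreteDomainGraph Ω.carrier δ) (meshDomainFinset Ω.carrier δ) criticalBetaTwo 0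
        BoundaryCondition.free (nearestSite δ z) (nearestSite δ w) ≤
      meshIsingFreeDualCorr Ω' δ (nearestSite δ z + k) (nearestSite δ w + k) := by
  obtain ⟨r, hr, hrΩ', hKc⟩ := exists_cthickening_subset Ω.isBounded.isCompact_closure hΩ'o h'
  set C : ℝ := |((k 0 : ℤ) : ℝ)| + |((k 1 : ℤ) : ℝ)| with hC
  have hsmall : ∀ᶠ δ in 𝓝[>] (0 : ℝ), δ * C ≤ r := by
    have h : Tendsto (fun δ : ℝ => δ * C) (𝓝 0) (𝓝 (0 * C)) := tendsto_id.mul_const C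
    rw [zero_mul] at h
    exact mem_nhdsWithin_of_mem_nhds (h.eventually (Iic_mem_nhds hr))
  filter_upwards [hM'.2.2 _ hKc hrΩ', Ω.eventually_nearestSite_mem_meshDomain hz,
    Ω.eventually_nearestSite_mem_meshDomain hw, eventually_nearestSite_ne hzw, hsmall,
    self_mem_nhdsWithin] with δ hKP hz' hw' hne hδC hδ
  have hδ0 : (0 : ℝ) < δ := hδ
  -- sites of `Ω_δ` translated by `k` are free faces of `Ω'_δ`
  have hΛ : ∀ u ∈ meshDomain Ω.carrier δ, u + k ∈ meshInteriorFinset Ω' δ := by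
    intro u hu
    have huΩ : meshPoint δ u ∈ closure Ω.carrier := subset_closure (meshDomain_subset_meshVertices _ δ hu)
    have hK' : meshPoint δ (u + k) ∈ cthickening r (closure Ω.carrier) := by
      refine Metric.mem_cthickening_of_dist_le _ (meshPoint δ u) r _ huΩ ?_
      rw [meshPoint_add_site, dist_eq_norm, add_sub_cancel_left]
      exact (norm_meshPoint_le hδ0.le k).trans hδC
    exact mem_of_mem_meshPolygon hδ0 (hKP hK') (meshPoint_mem_meshCell hδ0.le _)
  -- hence `Ω_δ ⊆` translated dual sites, and `Ω_δ ≤` translated dual graph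
  have hVD : meshDomainFinset Ω.carrier δ ⊆ (dualSites (meshInteriorFinset Ω' δ)).map (Site.shift (-k)).toEmbedding := by
    intro u hu
    rw [← Finset.mem_coe, coe_meshDomainFinset Ω.isBounded hδ0] at hu
    rw [Finset.mem_map]
    exact ⟨u + k, mem_dualSites_of_mem (hΛ u hu), by simp [Site.shift_apply]⟩
  have hG'le : discreteDomainGraph Ω.carrier δ ≤ (kwDual (meshInteriorFinset Ω' δ)).map (Site.shift (-k)).toEmbedding := by
    intro u v huv
    rw [discreteDomainGraph_adj_iff, meshGraph_adj_iff] at huv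
    obtain ⟨⟨hadj, -⟩, hu, hv⟩ := huv
    have hadj' : (zdGraph 2).Adj (u + k) (v + k) := (zdGraph_adj_shift_iff k u v).2 hadj
    have hd : (kwDual (meshInteriorFinset Ω' δ)).Adj (u + k) (v + k) := kwDual_adj_of_adj_of_mem hadj' (hΛ u hu) (hΛ v hv)
    have hu' : u = (Site.shift (-k)).toEmbedding (u + k) := by simp [Site.shift_apply]
    have hv' : v = (Site.shift (-k)).toEmbedding (v + k) := by simp [Site.shift_apply]
    rw [hu', hv', SimpleGraph.map_adj_apply]
    exact hd
  have hAD : ({nearestSite δ z, nearestSite δ w} : Finset (Site 2)) ⊆ meshDomainFinset Ω.carrier δ := by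
    intro x hx
    rw [← Finset.mem_coe, coe_meshDomainFinset Ω.isBounded hδ0]
    simp only [Finset.mem_insert, Finset.mem_singleton] at hx
    rcases hx with rfl | rfl
    · exact hz'
    · exact hw'
  rw [isingTwoPoint_free_eq_isingCorr_pair _ hne, meshIsingFreeDualCorr,
    ← isingCorr_map_kwDual_shift (meshInteriorFinset Ω' δ) (-k), ← pair_eq_map_shift_neg _ _ k]
  calc isingCorr (discreteDomainGraph Ω.carrier δ) (meshDomainFinset Ω.carrier δ) criticalBetaTwo 0 .free
        {nearestSite δ z, nearestSite δ w}
      ≤ isingCorr (discreteDomainGraph Ω.carrier δ)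
        ((dualSites (meshInteriorFinset Ω' δ)).map (Site.shift (-k)).toEmbedding) criticalBetaTwo 0 .free
        {nearestSite δ z, nearestSite δ w} :=
        isingCorr_free_le_of_subset _ criticalBetaTwo_pos.le le_rfl hAD hVD
    _ ≤ isingCorr ((kwDual (meshInteriorFinset Ω' δ)).map (Site.shift (-k)).toEmbedding)
        ((dualSites (meshInteriorFinset Ω' δ)).map (Site.shift (-k)).toEmbedding) criticalBetaTwo 0 .free
        {nearestSite δ z, nearestSite δ w} :=
        isingCorr_free_mono_graph (fun Λ A B β h bc => GKSInequalities.gks_two_holds _) hG'le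
          criticalBetaTwo_pos.le le_rfl (hAD.trans hVD)


/-! ### The fact from Thm 1.5 (`k = 1`), Remark 2.18 and Thm 1.7 as printed -/

/-- **Squeeze with vertex domains.** Let `Ω` be Jordan, `z ≠ w` in `Ω`, `T ∈ ℝ`, and offsets
`o₁, o₂`. Suppose that for every `ε > 0` there are an inner open domain `Ω₀` (`closure Ω₀ ⊆ Ω`,
`z, w ∈ Ω₀`, `MeshApproximates Ω₀`) whose vertex-domain quotient
`𝔼^free_{(Ω₀)•_δ}[σ_{[z/δ]+o₁}σ_{[y_δ/δ]+o₂}]/ϱ(δ)`, `y_δ = w + δ(o₁ - o₂)`, tends to some `T₀ > T - ε`,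
and an outer open domain `Ω'` (`closure Ω ⊆ Ω'`, `MeshApproximates Ω'`) whose quotient tends to some
`T' < T + ε`. Then the quotient of the fact's model (all sites of `Ω_δ` free) tends to `T`.
[cite: ChelkakHonglerIzyurovAnnals2015, §2.9 p. 19 ("independent of the particular choice of lattice approximations")] -/
theorem _root_.Literature.Probability.RandomPlanarGeometry.JordanDomain.tendsto_isingTwoPoint_free_div_rhoCHI_of_dual_sandwich
    (Ω : JordanDomain) {z w : ℂ} (hz : z ∈ Ω.carrier) (hw : w ∈ Ω.carrier) (hzw : z ≠ w) {T : ℝ} (o₁ o₂ : Site 2)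
    (hinner : ∀ ε > (0 : ℝ), ∃ (Ω₀ : Set ℂ) (T₀ : ℝ), IsOpen Ω₀ ∧ MeshApproximates Ω₀ ∧ closure Ω₀ ⊆ Ω.carrier ∧
      z ∈ Ω₀ ∧ w ∈ Ω₀ ∧ T - ε < T₀ ∧
      Tendsto (fun δ => meshIsingFreeDualCorr Ω₀ δ (nearestSite δ z + o₁)
        (nearestSite δ (w + meshPoint δ (o₁ - o₂)) + o₂) / rhoCHI δ) (𝓝[>] 0) (𝓝 T₀))
    (houter : ∀ ε > (0 : ℝ), ∃ (Ω' : Set ℂ) (T' : ℝ), IsOpen Ω' ∧ MeshApproximates Ω' ∧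
      closure Ω.carrier ⊆ Ω' ∧ T' < T + ε ∧
      Tendsto (fun δ => meshIsingFreeDualCorr Ω' δ (nearestSite δ z + o₁)
        (nearestSite δ (w + meshPoint δ (o₁ - o₂)) + o₂) / rhoCHI δ) (𝓝[>] 0) (𝓝 T')) :
    Tendsto (fun δ : ℝ => isingTwoPoint (discreteDomainGraph Ω.carrier δ)
        (meshDomainFinset Ω.carrier δ) criticalBetaTwo 0 BoundaryCondition.free
        (nearestSite δ z) (nearestSite δ w) / rhoCHI δ) (𝓝[>] 0) (𝓝 T) := by
  have hround : ∀ δ : ℝ, 0 < δ → nearestSite δ (w + meshPoint δ (o₁ - o₂)) + o₂ = nearestSite δ w + o₁ := by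
    intro δ hδ
    rw [nearestSite_add_meshPoint hδ.ne']
    abel
  rw [Metric.tendsto_nhds]
  intro ε hε
  obtain ⟨Ω₀, T₀, hΩ₀o, hM₀, h₀, hz₀, hw₀, hT₀, hlim₀⟩ := hinner ε hε
  obtain ⟨Ω', T', hΩ'o, hM', h', hT', hlim'⟩ := houter ε hε
  filter_upwards [eventually_freeDual_inner_le Ω hΩ₀o hM₀ h₀ hz₀ hw₀ hzw o₁,
    eventually_le_freeDual_outer Ω hM' h' hΩ'o hz hw hzw o₁,
    hlim₀.eventually_const_lt hT₀, hlim'.eventually_lt_const hT', self_mem_nhdsWithin] with δ hlo hup h1 h2 hδ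
  rw [hround δ hδ] at h1 h2
  rw [Real.dist_eq, abs_sub_lt_iff]
  have hρ := rhoCHI_pos δ
  constructor
  · have := div_le_div_of_nonneg_right hup hρ.le
    linarith
  · have := div_le_div_of_nonneg_right hlo hρ.le
    linarith

/-- **`chi_twoPoint_free_jordan` from CHI Thm 1.5 (`k = 1`), Remark 2.18 and Thm 1.7 AS PRINTED.**
The named fact `chi_twoPoint_free_jordan` (CHI Thm 1.1, free boundary conditions, `ϱ`-normalised,
for the canonical discretisation of an arbitrary Jordan domain, all sites free) follows from
`h₁`, `h₂` — VERBATIM the bodies of the named facts `chi_plusTwoPoint_diagLogDerivative`,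
`chi_plusTwoPoint_nnRatio` (`PlanarIsingOnePointSplit.lean`) — and `hM` — CHI Thm 1.7 in its printed
mixed-family form: for every admissible approximable `Ω`, conformal `φ : Ω → ℍ`, `x ∈ Ω` and
`y_δ → y₀ ∈ Ω ∖ {x}`,
`𝔼^free_{Ω•_δ}[σ_{[x/δ]+o₁}σ_{[y_δ/δ]+o₂}] / 𝔼⁺_{Ω_δ}[σ_xσ_{y_δ}] → 𝓑_Ω(x; y₀) = bCHI (φ x) (φ y₀)`,
with fixed offsets `o₁ o₂` (the vertices "`a + δ`, `b + δ`" of CHI's faces `a, b`). The third child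
`chi_freePlusTwoPoint_ratio` of the split (the same-family form of Thm 1.7) is NOT used. Assembly:
`chi_twoPoint_freeDual_rho_of_mixed` (CHI §2.9 for vertex domains) +
`JordanDomain.exists_inner_outer_approximants_close` (polyomino approximants, Carathéodory kernel
theorem) + the Griffiths sandwich with translated vertex domains.
[cite: ChelkakHonglerIzyurovAnnals2015, Thm. 1.1 (free boundary conditions), §2.9 p. 19; via Thm. 1.5, Remark 2.18, Thm. 1.7 (as printed, eq. (2.12))] -/
theorem chi_twoPoint_free_jordan_of_mixed (o₁ o₂ : Site 2)
    (h₁ : ∀ (Ω : Set ℂ), IsAdmissibleDomain Ω → MeshApproximates Ω → ∀ (φ : ℂ → ℂ),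
      IsConformalBijection φ Ω UpperHalfPlane.upperHalfPlaneSet → ∀ x ∈ Ω,
        ∀ K ⊆ Ω \ {x}, IsCompact K → ∀ s ∈ LatticeRatio.diagSteps, ∀ ε > (0 : ℝ), ∀ᶠ δ in 𝓝[>] (0 : ℝ),
          ∀ v : Site 2, meshPoint δ v ∈ K →
            |(meshIsingPlusCorr Ω δ ![x, meshPoint δ (v + s)] / meshIsingPlusCorr Ω δ ![x, meshPoint δ v] - 1) / δ -
              (ACHI φ (meshPoint δ v) x * Site.toComplex s).re| < ε)
    (h₂ : ∀ (Ω : Set ℂ), IsAdmissibleDomain Ω → MeshApproximates Ω → ∀ (φ : ℂ → ℂ),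
      IsConformalBijection φ Ω UpperHalfPlane.upperHalfPlaneSet → ∀ x ∈ Ω,
        ∀ K ⊆ Ω \ {x}, IsCompact K → ∀ s ∈ LatticeRatio.nnSteps, ∀ ε > (0 : ℝ), ∀ᶠ δ in 𝓝[>] (0 : ℝ),
          ∀ v : Site 2, meshPoint δ v ∈ K →
            |meshIsingPlusCorr Ω δ ![x, meshPoint δ (v + s)] / meshIsingPlusCorr Ω δ ![x, meshPoint δ v] - 1| < ε)
    (hM : ∀ (Ω : Set ℂ), IsAdmissibleDomain Ω → MeshApproximates Ω → ∀ (φ : ℂ → ℂ),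
      IsConformalBijection φ Ω UpperHalfPlane.upperHalfPlaneSet →
        ∀ x ∈ Ω, ∀ (y : ℝ → ℂ) (y₀ : ℂ), y₀ ∈ Ω → y₀ ≠ x → Tendsto y (𝓝[>] 0) (𝓝 y₀) →
          Tendsto (fun δ => meshIsingFreeDualCorr Ω δ (nearestSite δ x + o₁) (nearestSite δ (y δ) + o₂) /
              meshIsingPlusCorr Ω δ ![x, y δ]) (𝓝[>] 0) (𝓝 (bCHI (φ x) (φ y₀)))) :
    chi_twoPoint_free_jordan := by
  have hT := chi_twoPoint_freeDual_rho_of_mixed o₁ o₂ h₁ h₂ hM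
  intro Ω ψ hψ z hz w hw hzw
  have hy : Tendsto (fun δ : ℝ => w + meshPoint δ (o₁ - o₂)) (𝓝[>] 0) (𝓝 w) :=
    tendsto_add_meshPoint tendsto_const_nhds _
  refine Ω.tendsto_isingTwoPoint_free_div_rhoCHI_of_dual_sandwich hz hw hzw o₁ o₂ (fun ε hε => ?_) (fun ε hε => ?_)
  · obtain ⟨⟨Ω₀, ψ₀, hΩ₀, hM₀, h₀, hz₀, hw₀, hψ₀, hε₀⟩, -⟩ :=
      Ω.exists_inner_outer_approximants_close ψ hψ z hz w hw hzw ε hε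
    refine ⟨Ω₀, twoPointFreeCHI ψ₀ z w, hΩ₀.1, hM₀, h₀, hz₀, hw₀, ?_,
      hT Ω₀ hΩ₀ hM₀ ψ₀ hψ₀ z hz₀ _ w hw₀ hzw.symm hy⟩
    have := (abs_sub_lt_iff.1 hε₀).2
    linarith
  · obtain ⟨-, ⟨Ω', ψ', hΩ', hM', h', hψ', hε'⟩⟩ :=
      Ω.exists_inner_outer_approximants_close ψ hψ z hz w hw hzw ε hε
    refine ⟨Ω', twoPointFreeCHI ψ' z w, hΩ'.1, hM', h', ?_,
      hT Ω' hΩ' hM' ψ' hψ' z (h' (subset_closure hz)) _ w (h' (subset_closure hw)) hzw.symm hy⟩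
    have := (abs_sub_lt_iff.1 hε').1
    linarith

/-- Pointed form with the two named facts: `chi_twoPoint_free_jordan` follows from
`chi_plusTwoPoint_diagLogDerivative`, `chi_plusTwoPoint_nnRatio` (CHI Thm 1.5 (`k = 1`), Remark 2.18)
and CHI Thm 1.7 as printed (`hM`, mixed families, offsets `o₁ o₂`).
[cite: ChelkakHonglerIzyurovAnnals2015, Thm. 1.1 (free boundary conditions); via Thm. 1.5, Remark 2.18, Thm. 1.7] -/
theorem chi_twoPoint_free_jordan_of_facts_of_mixed (o₁ o₂ : Site 2) (h₁ : chi_plusTwoPoint_diagLogDerivative)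
    (h₂ : chi_plusTwoPoint_nnRatio)
    (hM : ∀ (Ω : Set ℂ), IsAdmissibleDomain Ω → MeshApproximates Ω → ∀ (φ : ℂ → ℂ),
      IsConformalBijection φ Ω UpperHalfPlane.upperHalfPlaneSet →
        ∀ x ∈ Ω, ∀ (y : ℝ → ℂ) (y₀ : ℂ), y₀ ∈ Ω → y₀ ≠ x → Tendsto y (𝓝[>] 0) (𝓝 y₀) →
          Tendsto (fun δ => meshIsingFreeDualCorr Ω δ (nearestSite δ x + o₁) (nearestSite δ (y δ) + o₂) /
              meshIsingPlusCorr Ω δ ![x, y δ]) (𝓝[>] 0) (𝓝 (bCHI (φ x) (φ y₀)))) :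
    chi_twoPoint_free_jordan :=
  chi_twoPoint_free_jordan_of_mixed o₁ o₂ h₁ h₂ hM

end Literature.Probability.LatticeModels
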